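import Literature.NumberTheory.LFunctions.ExplicitThirdDerivTest
import Literature.NumberTheory.LFunctions.DhirRpow
import HarnessLib

/-!
# Yang's explicit `k`-th derivative test (Yang 2024, Lemma 2.5; Patel–Yang 2024, Lemma 1.4)

Topic `Literature/NumberTheory/LFunctions`. A. Yang, *Explicit bounds on `ζ(s)` in the critical
strip and a zero-free region*, J. Math. Anal. Appl. 534 (2024) = arXiv:2301.03165, Lemma 2.5
(explicit `k`th derivative test): "Let `a, N` be integers with `N > 0`. Let `f(x)` be equipped
with `k ≥ 4` continuous derivatives, with `f^{(k)}` monotonic, and suppose that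
`0 < λ_k ≤ |f^{(k)}(x)| ≤ hλ_k` for all `x ∈ (a, a + N]` and some `h > 1`. Then
`S_f(a, N) ≤ A_k h^{2/K} N λ_k^{1/(2K-2)} + B_k N^{1-2/K} λ_k^{-1/(2K-2)}`
where `K = 2^{k-1}`, `A_3(η_3, h)` and `B_3(η_3)` are defined in Lemma 2.4, and `A_k, B_k` for `k ≥ 4`
are defined recursively via `A_{j+1}(η_3, h) := δ_j (h^{-1/J} + 2^{19/12}(J-1)/√((2J-1)(4J-3)) A_j^{1/2})`,
`B_{j+1}(η_3) := δ_j 2^{3/2}(J-1)/√((2J-3)(4J-5)) B_j^{1/2}`,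
`δ_j := √(1 + (2/2337^{1-2/J})(9πη_3/1024)^{1/J})`, where `J := 2^{j-1}`." This is Lemma 1.4
of Patel–Yang (J. Number Theory 262 (2024)), recursion (1.3)–(1.5), used there with `k = 4, 5`
in the proof of the explicit sub-Weyl bound for `ζ(1/2 + it)`.

Everything here is PROVED (the statement for every `k ≥ 3`; `k = 3` is Lemma 2.4,
`Literature.NumberTheory.LFunctions.VdC.thirdDerivTest_yang`), following the printed induction: the
explicit `A`-process (`…aProcess_yang`), the induction hypothesis for the differenced families
`g_r = f(· + r) - f` (tree `Literature.NumberTheory.LFunctions.VdC.DerivFamily.diff`,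
`….diff_bound`), the weighted power sums `∑ (1 - r/q) r^{±1/(2J-2)}` (`…dhir_rpow_pos/neg`),
`q = ⌊λ^{-1/(2J-1)}⌋ + 1`, and the trivial bound in the extreme ranges `N ≤ 2336`
(through `A_kB_k > 2^{1/6-2/(3K)}(A₃B₃)^{4/K}`, `A₃B₃ ≥ 32/(3√(5π))`, `2^{25/3}(32/(3√(5π)))² > 2336`)
and `λ ≤ λ₀(k)` (through `B_k ≥ B₃^{4/K}`).

Formalisation notes (affecting hypotheses only, all weaker than or equivalent to the printed
ones): `h ≥ 1` suffices; the monotonicity of `f^{(k)}` is not used (nor is it in the printed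
proof); the hypothesis `λ ≤ |f^{(k)}| ≤ hλ` is taken as a constant-sign bound on `[a, b]`
(`λ ≤ D k ≤ hλ` or `λ ≤ -D k ≤ hλ`), the derivatives being given as a family `D 0 = f, …, D k`
with `HasDerivAt (D j) (D (j+1) y) y` on `[a, b]`; the printed choice `q ≤ 2λ^{-1/(2J-1)}`
presupposes `λ ≤ 1`, and for `λ ≥ 1` the bound follows from the trivial one since
`A_{j+1} h^{1/J} ≥ δ_j ≥ 1` (range 1 of `…kth_step`).

## Definitions (the printed constants)

* `Literature.NumberTheory.LFunctions.VdC.yangJ j = 2^{j-1}`, `…yangCJ J = 2^{19/12}(J-1)/√((2J-1)(4J-3))`,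
  `…yangDJ J = 2^{3/2}(J-1)/√((2J-3)(4J-5))`, `…yangDeltaJ η J = δ`, `…yangA η h j = A_j(η, h)`,
  `…yangB η j = B_j(η)` (for `j < 3` set to the values at `3`), `…yangKRHS` (the right-hand side).

## Main results

* `Literature.NumberTheory.LFunctions.VdC.kth_step` — the induction step `j → j + 1` (`j ≥ 3`).
* `Literature.NumberTheory.LFunctions.VdC.kthDerivTest_yang` — **Yang's Lemma 2.5** for all `k ≥ 3`.
* Invariants of the recursion: `…yangCJ_mul_yangDJ_ge` (`c_Jd_J ≥ 2^{1/12}`), `…yangAB_pow_ge`,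
  `…yang_threshold`, `…yangB_pow_ge`, `…yangA3B3_sq_ge`, `…numeric_2336`.

## References

* A. Yang, *Explicit bounds on `ζ(s)` in the critical strip and a zero-free region*, J. Math.
  Anal. Appl. 534 (2024) 128124 = arXiv:2301.03165v3, Lemma 2.5 and its proof.
  [cite: Yang2024, Lemma 2.5]
* D. Patel, A. Yang, *An explicit sub-Weyl bound for `ζ(1/2 + it)`*, J. Number Theory 262
  (2024) 301–334, Lemma 1.4 and (1.3)–(1.5). [cite: PatelYang2024, Lemma 1.4]
-/

noncomputable section

open Finset Real

namespace Literature.NumberTheory.LFunctions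
namespace VdC

/-! ### The constants of the recursion -/

/-- Yang's `c_J := 2^{19/12}(J-1)/√((2J-1)(4J-3))` (coefficient of `A_j^{1/2}` in `A_{j+1}`).
[cite: Yang2024, Lemma 2.5] -/
def yangCJ (J : ℝ) : ℝ := (2 : ℝ) ^ (19 / 12 : ℝ) * (J - 1) / Real.sqrt ((2 * J - 1) * (4 * J - 3))

/-- Yang's `d_J := 2^{3/2}(J-1)/√((2J-3)(4J-5))` (coefficient of `B_j^{1/2}` in `B_{j+1}`).
[cite: Yang2024, Lemma 2.5] -/
def yangDJ (J : ℝ) : ℝ := (2 : ℝ) ^ (3 / 2 : ℝ) * (J - 1) / Real.sqrt ((2 * J - 3) * (4 * J - 5))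

/-- Yang's `δ_j := √(1 + (2/2337^{1-2/J}) (9πη/1024)^{1/J})`, `J = 2^{j-1}`. [cite: Yang2024, Lemma 2.5] -/
def yangDeltaJ (η J : ℝ) : ℝ :=
  Real.sqrt (1 + 2 / (2337 : ℝ) ^ (1 - 2 / J) * (9 * π / 1024 * η) ^ (1 / J))

/-- `J = 2^{j-1}` as a real number (for `j ≥ 1`; we only use `j ≥ 3`). [cite: Yang2024, Lemma 2.5] -/
def yangJ (j : ℕ) : ℝ := (2 : ℝ) ^ (j - 1)

/-- Yang's `A_j(η, h)`: `A_3` from Lemma 2.4 and `A_{j+1} = δ_j (h^{-1/J} + c_J A_j^{1/2})` for `j ≥ 3`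
(`J = 2^{j-1}`); the values for `j < 3` are irrelevant (set to `A_3`). [cite: Yang2024, Lemma 2.5] -/
def yangA (η h : ℝ) : ℕ → ℝ
  | 0 => yangA3 η h
  | 1 => yangA3 η h
  | 2 => yangA3 η h
  | 3 => yangA3 η h
  | n + 4 => yangDeltaJ η (yangJ (n + 3)) *
      (h ^ (-(1 / yangJ (n + 3))) + yangCJ (yangJ (n + 3)) * Real.sqrt (yangA η h (n + 3)))

/-- Yang's `B_j(η)`: `B_3` from Lemma 2.4 and `B_{j+1} = δ_j d_J B_j^{1/2}` for `j ≥ 3`. [cite: Yang2024, Lemma 2.5] -/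
def yangB (η : ℝ) : ℕ → ℝ
  | 0 => yangB3 η
  | 1 => yangB3 η
  | 2 => yangB3 η
  | 3 => yangB3 η
  | n + 4 => yangDeltaJ η (yangJ (n + 3)) * yangDJ (yangJ (n + 3)) * Real.sqrt (yangB η (n + 3))

section constants

variable {η h : ℝ}

/-- `J = 4` at order `3`. [folklore] -/
theorem yangJ_three : yangJ 3 = 4 := by norm_num [yangJ]

/-- `J` doubles with the order. [folklore] -/
theorem yangJ_succ (j : ℕ) (hj : 1 ≤ j) : yangJ (j + 1) = 2 * yangJ j := by
  unfold yangJ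
  rw [show j + 1 - 1 = (j - 1) + 1 by omega, pow_succ]; ring

/-- `J ≥ 4` for `j ≥ 3`. [folklore] -/
theorem four_le_yangJ {j : ℕ} (hj : 3 ≤ j) : 4 ≤ yangJ j := by
  unfold yangJ
  calc (4 : ℝ) = 2 ^ 2 := by norm_num
    _ ≤ 2 ^ (j - 1) := pow_le_pow_right₀ (by norm_num) (by omega)

/-- `J > 0`. [folklore] -/
theorem yangJ_pos (j : ℕ) : 0 < yangJ j := by unfold yangJ; positivity

/-- The recursion for `A`, `j ≥ 3`. [cite: Yang2024, Lemma 2.5] -/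
theorem yangA_succ (η h : ℝ) {j : ℕ} (hj : 3 ≤ j) :
    yangA η h (j + 1) = yangDeltaJ η (yangJ j) *
      (h ^ (-(1 / yangJ j)) + yangCJ (yangJ j) * Real.sqrt (yangA η h j)) := by
  obtain ⟨n, rfl⟩ : ∃ n, j = n + 3 := ⟨j - 3, by omega⟩
  rfl

/-- The recursion for `B`, `j ≥ 3`. [cite: Yang2024, Lemma 2.5] -/
theorem yangB_succ (η : ℝ) {j : ℕ} (hj : 3 ≤ j) :
    yangB η (j + 1) = yangDeltaJ η (yangJ j) * yangDJ (yangJ j) * Real.sqrt (yangB η j) := by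
  obtain ⟨n, rfl⟩ : ∃ n, j = n + 3 := ⟨j - 3, by omega⟩
  rfl

/-- `A` at order `3` is `A₃`. [cite: Yang2024, Lemma 2.5] -/
theorem yangA_three (η h : ℝ) : yangA η h 3 = yangA3 η h := rfl
/-- `B` at order `3` is `B₃`. [cite: Yang2024, Lemma 2.5] -/
theorem yangB_three (η : ℝ) : yangB η 3 = yangB3 η := rfl

/-- `δ_J ≥ 1`. [folklore] -/
theorem one_le_yangDeltaJ (hη : 0 ≤ η) (J : ℝ) : 1 ≤ yangDeltaJ η J := by
  unfold yangDeltaJ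
  rw [show (1:ℝ) = Real.sqrt 1 by rw [Real.sqrt_one]]
  refine Real.sqrt_le_sqrt ?_
  rw [Real.sqrt_one]
  have : 0 ≤ 2 / (2337 : ℝ) ^ (1 - 2 / J) * (9 * π / 1024 * η) ^ (1 / J) := by positivity
  linarith

/-- `δ_J > 0`. [folklore] -/
theorem yangDeltaJ_pos (hη : 0 ≤ η) (J : ℝ) : 0 < yangDeltaJ η J :=
  lt_of_lt_of_le one_pos (one_le_yangDeltaJ hη J)

/-- `64(J-1)⁴ - (2J-1)(2J-3)(4J-3)(4J-5) = 20(J-1)² - 1`. [folklore] -/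
theorem poly_identity (J : ℝ) :
    64 * (J - 1) ^ 4 - (2 * J - 1) * (2 * J - 3) * (4 * J - 3) * (4 * J - 5) = 20 * (J - 1) ^ 2 - 1 := by
  ring

/-- `c_J > 0`, `d_J ≥ 1` for `J ≥ 4`. [folklore] -/
theorem yangCJ_pos {J : ℝ} (hJ : 4 ≤ J) : 0 < yangCJ J := by
  unfold yangCJ
  have h1 : 0 < (2 * J - 1) * (4 * J - 3) := by nlinarith
  have h2 : 0 < J - 1 := by linarith
  have h3 : 0 < Real.sqrt ((2 * J - 1) * (4 * J - 3)) := Real.sqrt_pos.2 h1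
  positivity

/-- `d_J ≥ 1` for `J ≥ 4` (`8(J-1)² - (2J-3)(4J-5) = 6J - 7 ≥ 0`). [cite: Yang2024, Lemma 2.5 (proof)] -/
theorem one_le_yangDJ {J : ℝ} (hJ : 4 ≤ J) : 1 ≤ yangDJ J := by
  unfold yangDJ
  have hprod : 0 < (2 * J - 3) * (4 * J - 5) := by nlinarith
  have hs : 0 < Real.sqrt ((2 * J - 3) * (4 * J - 5)) := Real.sqrt_pos.2 hprod
  rw [le_div_iff₀ hs, one_mul]
  -- `√((2J-3)(4J-5)) ≤ 2^{3/2}(J-1)` iff `(2J-3)(4J-5) ≤ 8(J-1)²` (`6J - 7 ≥ 0`)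
  have h232 : ((2 : ℝ) ^ (3 / 2 : ℝ)) ^ 2 = 8 := by
    rw [← Real.rpow_natCast, ← Real.rpow_mul (by norm_num)]; norm_num
  have h2pos : 0 < (2 : ℝ) ^ (3 / 2 : ℝ) := by positivity
  have key : (2 * J - 3) * (4 * J - 5) ≤ ((2 : ℝ) ^ (3 / 2 : ℝ) * (J - 1)) ^ 2 := by
    rw [mul_pow, h232]; nlinarith
  calc Real.sqrt ((2 * J - 3) * (4 * J - 5)) ≤ Real.sqrt (((2 : ℝ) ^ (3 / 2 : ℝ) * (J - 1)) ^ 2) :=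
        Real.sqrt_le_sqrt key
    _ = (2 : ℝ) ^ (3 / 2 : ℝ) * (J - 1) := Real.sqrt_sq (by nlinarith)

/-- `d_J > 0`. [folklore] -/
theorem yangDJ_pos {J : ℝ} (hJ : 4 ≤ J) : 0 < yangDJ J := lt_of_lt_of_le one_pos (one_le_yangDJ hJ)

/-- `c_J d_J ≥ 2^{1/12}` for `J ≥ 4` (from `64(J-1)⁴ ≥ (2J-1)(2J-3)(4J-3)(4J-5)`). [cite: Yang2024, Lemma 2.5 (proof)] -/
theorem yangCJ_mul_yangDJ_ge {J : ℝ} (hJ : 4 ≤ J) : (2 : ℝ) ^ (1 / 12 : ℝ) ≤ yangCJ J * yangDJ J := by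
  unfold yangCJ yangDJ
  have hp1 : 0 < (2 * J - 1) * (4 * J - 3) := by nlinarith
  have hp2 : 0 < (2 * J - 3) * (4 * J - 5) := by nlinarith
  set P : ℝ := (2 * J - 1) * (4 * J - 3) * ((2 * J - 3) * (4 * J - 5)) with hP
  have hP0 : 0 < P := mul_pos hp1 hp2
  have hsP : Real.sqrt ((2 * J - 1) * (4 * J - 3)) * Real.sqrt ((2 * J - 3) * (4 * J - 5)) = Real.sqrt P := by
    rw [hP, ← Real.sqrt_mul hp1.le]
  have e : (2 : ℝ) ^ (19 / 12 : ℝ) * (J - 1) / Real.sqrt ((2 * J - 1) * (4 * J - 3))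
      * ((2 : ℝ) ^ (3 / 2 : ℝ) * (J - 1) / Real.sqrt ((2 * J - 3) * (4 * J - 5)))
      = (2 : ℝ) ^ (19 / 12 : ℝ) * (2 : ℝ) ^ (3 / 2 : ℝ) * (J - 1) ^ 2 / Real.sqrt P := by
    rw [← hsP]; field_simp
  rw [e]
  have h2e : (2 : ℝ) ^ (19 / 12 : ℝ) * (2 : ℝ) ^ (3 / 2 : ℝ) = (2 : ℝ) ^ (1 / 12 : ℝ) * 8 := by
    rw [← Real.rpow_add (by norm_num), show (8 : ℝ) = (2 : ℝ) ^ (3 : ℝ) by norm_num,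
      ← Real.rpow_add (by norm_num)]
    norm_num
  rw [h2e, le_div_iff₀ (Real.sqrt_pos.2 hP0)]
  -- need `2^{1/12} √P ≤ 2^{1/12} · 8 (J-1)²`, i.e. `√P ≤ 8(J-1)²`
  have hsqrtP : Real.sqrt P ≤ 8 * (J - 1) ^ 2 := by
    have : P ≤ (8 * (J - 1) ^ 2) ^ 2 := by
      have := poly_identity J
      rw [hP]; nlinarith
    calc Real.sqrt P ≤ Real.sqrt ((8 * (J - 1) ^ 2) ^ 2) := Real.sqrt_le_sqrt this
      _ = 8 * (J - 1) ^ 2 := Real.sqrt_sq (by positivity)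
  have h212 : 0 < (2 : ℝ) ^ (1 / 12 : ℝ) := by positivity
  nlinarith [mul_le_mul_of_nonneg_left hsqrtP h212.le]

/-- Positivity of `A_j`, `B_j` (`j ≥ 3`). [folklore] -/
theorem yangA_pos (hη : 0 < η) (hh : 1 ≤ h) : ∀ j, 3 ≤ j → 0 < yangA η h j := by
  intro j hj
  induction j, hj using Nat.le_induction with
  | base => rw [yangA_three]; exact yangA3_pos hη hh
  | succ j hj ih =>
    rw [yangA_succ η h hj]
    have hδ := yangDeltaJ_pos hη.le (yangJ j)
    have hc := yangCJ_pos (four_le_yangJ hj)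
    have : 0 < h := by linarith
    positivity

/-- Positivity of `B_j` (`j ≥ 3`). [folklore] -/
theorem yangB_pos (hη : 0 < η) : ∀ j, 3 ≤ j → 0 < yangB η j := by
  intro j hj
  induction j, hj using Nat.le_induction with
  | base => rw [yangB_three]; exact yangB3_pos hη
  | succ j hj ih =>
    rw [yangB_succ η hj]
    have hδ := yangDeltaJ_pos hη.le (yangJ j)
    have hd := yangDJ_pos (four_le_yangJ hj)
    have := Real.sqrt_pos.2 ih
    positivity

/-- `A_{j+1} ≥ c_J √A_j` (drop `δ_j ≥ 1` and `h^{-1/J} ≥ 0`). [cite: Yang2024, Lemma 2.5 (proof)] -/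
theorem yangA_succ_ge (hη : 0 < η) (hh : 1 ≤ h) {j : ℕ} (hj : 3 ≤ j) :
    yangCJ (yangJ j) * Real.sqrt (yangA η h j) ≤ yangA η h (j + 1) := by
  rw [yangA_succ η h hj]
  have hδ := one_le_yangDeltaJ hη.le (yangJ j)
  have hc := yangCJ_pos (four_le_yangJ hj)
  have h0 : 0 < h := by linarith
  have hpow : 0 ≤ h ^ (-(1 / yangJ j)) := Real.rpow_nonneg h0.le _
  have hx : 0 ≤ yangCJ (yangJ j) * Real.sqrt (yangA η h j) := by positivity
  nlinarith

/-- `B_{j+1}² ≥ B_j` (`δ_j, d_J ≥ 1`). [cite: Yang2024, Lemma 2.5 (proof)] -/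
theorem yangB_succ_sq_ge (hη : 0 < η) {j : ℕ} (hj : 3 ≤ j) : yangB η j ≤ yangB η (j + 1) ^ 2 := by
  rw [yangB_succ η hj]
  have hδ := one_le_yangDeltaJ hη.le (yangJ j)
  have hd := one_le_yangDJ (four_le_yangJ hj)
  have hB := yangB_pos hη j hj
  have hs : Real.sqrt (yangB η j) ^ 2 = yangB η j := Real.sq_sqrt hB.le
  have h1 : 1 ≤ (yangDeltaJ η (yangJ j) * yangDJ (yangJ j)) ^ 2 := by
    have : 1 ≤ yangDeltaJ η (yangJ j) * yangDJ (yangJ j) := by nlinarith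
    nlinarith
  calc yangB η j = 1 * Real.sqrt (yangB η j) ^ 2 := by rw [hs, one_mul]
    _ ≤ (yangDeltaJ η (yangJ j) * yangDJ (yangJ j)) ^ 2 * Real.sqrt (yangB η j) ^ 2 :=
        mul_le_mul_of_nonneg_right h1 (sq_nonneg _)
    _ = _ := by ring

/-- The product recursion: `A_{j+1} B_{j+1} ≥ 2^{1/12} (A_j B_j)^{1/2}`. [cite: Yang2024, Lemma 2.5 (proof)] -/
theorem yangAB_succ_ge (hη : 0 < η) (hh : 1 ≤ h) {j : ℕ} (hj : 3 ≤ j) :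
    (2 : ℝ) ^ (1 / 12 : ℝ) * Real.sqrt (yangA η h j * yangB η j) ≤ yangA η h (j + 1) * yangB η (j + 1) := by
  have hJ := four_le_yangJ hj
  have hA := yangA_pos hη hh j hj
  have hB := yangB_pos hη j hj
  have h1 := yangA_succ_ge hη hh hj
  have h2 : yangDJ (yangJ j) * Real.sqrt (yangB η j) ≤ yangB η (j + 1) := by
    rw [yangB_succ η hj]
    have hδ := one_le_yangDeltaJ hη.le (yangJ j)
    have : 0 ≤ yangDJ (yangJ j) * Real.sqrt (yangB η j) := by
      have := yangDJ_pos hJ; positivity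
    nlinarith
  have hcd := yangCJ_mul_yangDJ_ge hJ
  have hx : 0 ≤ yangCJ (yangJ j) * Real.sqrt (yangA η h j) := by have := yangCJ_pos hJ; positivity
  have hy : 0 ≤ yangDJ (yangJ j) * Real.sqrt (yangB η j) := by have := yangDJ_pos hJ; positivity
  calc (2 : ℝ) ^ (1 / 12 : ℝ) * Real.sqrt (yangA η h j * yangB η j)
      ≤ (yangCJ (yangJ j) * yangDJ (yangJ j)) * Real.sqrt (yangA η h j * yangB η j) :=
        mul_le_mul_of_nonneg_right hcd (Real.sqrt_nonneg _)
    _ = (yangCJ (yangJ j) * Real.sqrt (yangA η h j)) * (yangDJ (yangJ j) * Real.sqrt (yangB η j)) := by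
        rw [Real.sqrt_mul hA.le]; ring
    _ ≤ yangA η h (j + 1) * yangB η (j + 1) := mul_le_mul h1 h2 hy (hA |> fun _ => (yangA_pos hη hh _ (by omega)).le)


/-! ### The invariants of the recursion used in the extreme ranges -/

/-- `(A₃B₃)² ≥ 1024/(45π)` (i.e. `A₃B₃ ≥ 32/(3√(5π))`). [cite: Yang2024, Lemma 2.5 (proof)] -/
theorem yangA3B3_sq_ge (hη : 0 < η) (hh : 1 ≤ h) :
    1024 / (45 * π) ≤ (yangA3 η h * yangB3 η) ^ 2 := by
  have hπ := Real.pi_pos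
  have hsπ : 0 < Real.sqrt π := Real.sqrt_pos.2 hπ
  have hsη : 0 < Real.sqrt η := Real.sqrt_pos.2 hη
  have hδ := one_le_yangDelta3 hη
  have hδ0 := yangDelta3_pos hη
  have hh0 : 0 < h := by linarith
  have hM0 : 0 ≤ 1 / (η * h) + 32 / (15 * Real.sqrt π) * Real.sqrt η := by positivity
  -- `A₃² ≥ (32/(15√π)) √η`
  have hA : 32 / (15 * Real.sqrt π) * Real.sqrt η ≤ yangA3 η h ^ 2 := by
    have h1 := yangA3_div_ge hη hh
    have h0 : 0 ≤ Real.sqrt (1 / (η * h) + 32 / (15 * Real.sqrt π) * Real.sqrt η) * yangDelta3 η := by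
      positivity
    have h2 := pow_le_pow_left₀ h0 h1 2
    rw [mul_pow, Real.sq_sqrt hM0] at h2
    have h3 : 32 / (15 * Real.sqrt π) * Real.sqrt η ≤ (1 / (η * h) + 32 / (15 * Real.sqrt π) * Real.sqrt η) := by
      have : 0 ≤ 1 / (η * h) := by positivity
      linarith
    have h4 : (1:ℝ) ≤ yangDelta3 η ^ 2 := by nlinarith
    calc 32 / (15 * Real.sqrt π) * Real.sqrt η ≤ (1 / (η * h) + 32 / (15 * Real.sqrt π) * Real.sqrt η) * 1 := by
          linarith
      _ ≤ (1 / (η * h) + 32 / (15 * Real.sqrt π) * Real.sqrt η) * yangDelta3 η ^ 2 :=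
          mul_le_mul_of_nonneg_left h4 hM0
      _ ≤ yangA3 η h ^ 2 := h2
  -- `B₃² ≥ 32/(3√π√η)`
  have hB : 32 / (3 * Real.sqrt π * Real.sqrt η) ≤ yangB3 η ^ 2 := by
    rw [yangB3_sq hη]
    have h4 : (1:ℝ) ≤ yangDelta3 η ^ 2 := by nlinarith
    have h0 : 0 ≤ 32 / (3 * Real.sqrt π * Real.sqrt η) := by positivity
    nlinarith
  have e : 32 / (15 * Real.sqrt π) * Real.sqrt η * (32 / (3 * Real.sqrt π * Real.sqrt η)) = 1024 / (45 * π) := by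
    have := Real.mul_self_sqrt hπ.le
    field_simp
    nlinarith [this]
  rw [mul_pow, ← e]
  exact mul_le_mul hA hB (by positivity) (sq_nonneg _)

/-- The numerical inequality `256 · 2^{1/3} · 1024/(45π) > 2336` (`2^{25/3}(32/(3√(5π)))² > 2336`).
[cite: Yang2024, Lemma 2.5 (proof)] -/
theorem numeric_2336 : (2336 : ℝ) < 256 * (2 : ℝ) ^ (1 / 3 : ℝ) * (1024 / (45 * π)) := by
  have hπ := Real.pi_pos
  have hπ6 : π < 3.141593 := Real.pi_lt_d6
  -- `2^{1/3} > 1.2598` since `1.2598³ < 2`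
  have h2 : (1.2598 : ℝ) < (2 : ℝ) ^ (1 / 3 : ℝ) := by
    have h3 : ((1.2598 : ℝ) ^ 3) ^ (1 / 3 : ℝ) = 1.2598 := by
      rw [← Real.rpow_natCast, ← Real.rpow_mul (by norm_num)]; norm_num
    rw [← h3]
    exact Real.rpow_lt_rpow (by norm_num) (by norm_num) (by norm_num)
  rw [show (256 : ℝ) * (2 : ℝ) ^ (1 / 3 : ℝ) * (1024 / (45 * π)) = 256 * 1024 * (2 : ℝ) ^ (1 / 3 : ℝ) / (45 * π) by ring]
  rw [lt_div_iff₀ (by positivity)]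
  nlinarith

/-- The product invariant: for `j ≥ 4`, `(A_j B_j)^{2^{j-2}} ≥ 2^{1/3} (A₃B₃)²`
(`A_{j+1}B_{j+1} ≥ 2^{1/12}(A_jB_j)^{1/2}` iterated). [cite: Yang2024, Lemma 2.5 (proof)] -/
theorem yangAB_pow_ge (hη : 0 < η) (hh : 1 ≤ h) : ∀ j, 4 ≤ j →
    (2 : ℝ) ^ (1 / 3 : ℝ) * (yangA3 η h * yangB3 η) ^ 2 ≤ (yangA η h j * yangB η j) ^ (2 ^ (j - 2)) := by
  intro j hj
  induction j, hj using Nat.le_induction with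
  | base =>
    -- `(A₄B₄)⁴ ≥ (2^{1/12} √(A₃B₃))⁴ = 2^{1/3}(A₃B₃)²`
    have h1 := yangAB_succ_ge hη hh (le_refl 3)
    rw [yangA_three, yangB_three] at h1
    have hP := mul_pos (yangA3_pos hη hh) (yangB3_pos hη)
    have h0 : 0 ≤ (2 : ℝ) ^ (1 / 12 : ℝ) * Real.sqrt (yangA3 η h * yangB3 η) := by positivity
    have h2 := pow_le_pow_left₀ h0 h1 4
    show (2 : ℝ) ^ (1 / 3 : ℝ) * (yangA3 η h * yangB3 η) ^ 2 ≤ (yangA η h 4 * yangB η 4) ^ (2 ^ (4 - 2))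
    have e4 : (2 : ℕ) ^ (4 - 2) = 4 := by norm_num
    rw [e4]
    refine le_trans (le_of_eq ?_) h2
    have e1 : ((2 : ℝ) ^ (1 / 12 : ℝ)) ^ 4 = (2 : ℝ) ^ (1 / 3 : ℝ) := by
      rw [← Real.rpow_natCast, ← Real.rpow_mul (by norm_num)]; norm_num
    have e2 : Real.sqrt (yangA3 η h * yangB3 η) ^ 4 = (yangA3 η h * yangB3 η) ^ 2 := by
      rw [show (4:ℕ) = 2 * 2 from rfl, pow_mul, Real.sq_sqrt hP.le]
    rw [mul_pow ((2 : ℝ) ^ (1 / 12 : ℝ)), e1, e2]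
  | succ j hj ih =>
    have hj3 : 3 ≤ j := by omega
    have h1 := yangAB_succ_ge hη hh hj3
    have hP := mul_pos (yangA_pos hη hh j hj3) (yangB_pos hη j hj3)
    have h0 : 0 ≤ (2 : ℝ) ^ (1 / 12 : ℝ) * Real.sqrt (yangA η h j * yangB η j) := by positivity
    have h2 := pow_le_pow_left₀ h0 h1 (2 ^ (j - 1))
    rw [show j + 1 - 2 = j - 1 by omega]
    refine le_trans ?_ h2
    have e2 : Real.sqrt (yangA η h j * yangB η j) ^ (2 ^ (j - 1)) = (yangA η h j * yangB η j) ^ (2 ^ (j - 2)) := by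
      rw [show 2 ^ (j - 1) = 2 * 2 ^ (j - 2) by rw [← pow_succ']; congr 1; omega, pow_mul,
        Real.sq_sqrt hP.le]
    rw [mul_pow ((2 : ℝ) ^ (1 / 12 : ℝ)), e2]
    have h3 : (1 : ℝ) ≤ ((2 : ℝ) ^ (1 / 12 : ℝ)) ^ (2 ^ (j - 1)) :=
      one_le_pow₀ (Real.one_le_rpow (by norm_num) (by norm_num))
    have h4 : 0 ≤ (yangA η h j * yangB η j) ^ (2 ^ (j - 2)) := by positivity
    calc (2 : ℝ) ^ (1 / 3 : ℝ) * (yangA3 η h * yangB3 η) ^ 2 ≤ (yangA η h j * yangB η j) ^ (2 ^ (j - 2)) := ih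
      _ = 1 * (yangA η h j * yangB η j) ^ (2 ^ (j - 2)) := (one_mul _).symm
      _ ≤ ((2 : ℝ) ^ (1 / 12 : ℝ)) ^ (2 ^ (j - 1)) * (yangA η h j * yangB η j) ^ (2 ^ (j - 2)) :=
          mul_le_mul_of_nonneg_right h3 h4

/-- The trivial-bound threshold of the range `N ≤ 2336`: for `j ≥ 4` and `h ≥ 1`,
`2336 < 4^{2^{j-2}} (A_jB_j)^{2^{j-2}} h`. [cite: Yang2024, Lemma 2.5 (proof)] -/
theorem yang_threshold (hη : 0 < η) (hh : 1 ≤ h) {j : ℕ} (hj : 4 ≤ j) :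
    (2336 : ℝ) < (4 : ℝ) ^ (2 ^ (j - 2)) * (yangA η h j * yangB η j) ^ (2 ^ (j - 2)) * h := by
  have h1 := yangAB_pow_ge hη hh j hj
  have h2 := yangA3B3_sq_ge hη hh
  have h3 := numeric_2336
  have h4 : (256 : ℝ) ≤ (4 : ℝ) ^ (2 ^ (j - 2)) := by
    calc (256 : ℝ) = 4 ^ (2 ^ 2) := by norm_num
      _ ≤ 4 ^ (2 ^ (j - 2)) := pow_le_pow_right₀ (by norm_num) (Nat.pow_le_pow_right (by norm_num) (by omega))
  have h5 : 0 < (2 : ℝ) ^ (1 / 3 : ℝ) := by positivity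
  have h6 : (2 : ℝ) ^ (1 / 3 : ℝ) * (1024 / (45 * π)) ≤ (yangA η h j * yangB η j) ^ (2 ^ (j - 2)) := by
    calc (2 : ℝ) ^ (1 / 3 : ℝ) * (1024 / (45 * π)) ≤ (2 : ℝ) ^ (1 / 3 : ℝ) * (yangA3 η h * yangB3 η) ^ 2 :=
          mul_le_mul_of_nonneg_left h2 h5.le
      _ ≤ _ := h1
  have h7 : 0 ≤ (2 : ℝ) ^ (1 / 3 : ℝ) * (1024 / (45 * π)) := by positivity
  have h8 : 0 ≤ (4 : ℝ) ^ (2 ^ (j - 2)) * (yangA η h j * yangB η j) ^ (2 ^ (j - 2)) := by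
    have := yangA_pos hη hh j (by omega)
    have := yangB_pos hη j (by omega)
    positivity
  calc (2336 : ℝ) < 256 * (2 : ℝ) ^ (1 / 3 : ℝ) * (1024 / (45 * π)) := h3
    _ = 256 * ((2 : ℝ) ^ (1 / 3 : ℝ) * (1024 / (45 * π))) * 1 := by ring
    _ ≤ (4 : ℝ) ^ (2 ^ (j - 2)) * (yangA η h j * yangB η j) ^ (2 ^ (j - 2)) * h := by
        exact mul_le_mul (mul_le_mul h4 h6 h7 (by positivity)) hh zero_le_one h8

/-- The `B` invariant: `B_j^{2^{j-1}} ≥ 1024/(9πη)` for `j ≥ 3`. [cite: Yang2024, Lemma 2.5 (proof)] -/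
theorem yangB_pow_ge (hη : 0 < η) : ∀ j, 3 ≤ j → 1024 / (9 * π * η) ≤ yangB η j ^ (2 ^ (j - 1)) := by
  intro j hj
  induction j, hj using Nat.le_induction with
  | base =>
    rw [yangB_three]
    show 1024 / (9 * π * η) ≤ yangB3 η ^ (2 ^ (3 - 1))
    have e : yangB3 η ^ (2 ^ (3 - 1)) = (yangB3 η ^ 2) ^ 2 := by norm_num; ring
    rw [e, yangB3_sq hη]
    have hδ := one_le_yangDelta3 hη
    have hπ := Real.pi_pos
    have hsπ : 0 < Real.sqrt π := Real.sqrt_pos.2 hπ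
    have hsη : 0 < Real.sqrt η := Real.sqrt_pos.2 hη
    have h1' : (1:ℝ) ≤ yangDelta3 η ^ 2 := by nlinarith
    have h1 : (1:ℝ) ≤ (yangDelta3 η ^ 2) ^ 2 := by nlinarith
    have e2 : (32 / (3 * Real.sqrt π * Real.sqrt η)) ^ 2 = 1024 / (9 * π * η) := by
      rw [div_pow, mul_pow, mul_pow, Real.sq_sqrt hπ.le, Real.sq_sqrt hη.le]; norm_num
    rw [mul_pow, e2]
    have h0 : 0 ≤ 1024 / (9 * π * η) := by positivity
    nlinarith
  | succ j hj ih =>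
    have h1 := yangB_succ_sq_ge hη hj
    have hB := yangB_pos hη j hj
    have h2 := pow_le_pow_left₀ hB.le h1 (2 ^ (j - 1))
    rw [show j + 1 - 1 = j by omega]
    calc 1024 / (9 * π * η) ≤ yangB η j ^ (2 ^ (j - 1)) := ih
      _ ≤ (yangB η (j + 1) ^ 2) ^ (2 ^ (j - 1)) := h2
      _ = yangB η (j + 1) ^ (2 ^ j) := by
          rw [← pow_mul]; congr 1
          obtain ⟨i, rfl⟩ : ∃ i, j = i + 1 := ⟨j - 1, by omega⟩
          rw [Nat.add_sub_cancel, pow_succ]; ring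

end constants

/-! ### The induction step: auxiliary real-variable lemmas -/

/-- The right-hand side of Yang's `k`-th derivative test at order `j`:
`A_j h^{2/J} N λ^{1/(2J-2)} + B_j N^{1-2/J} λ^{-1/(2J-2)}`, `J = 2^{j-1}`. [cite: Yang2024, Lemma 2.5] -/
def yangKRHS (η h : ℝ) (j : ℕ) (N lam : ℝ) : ℝ :=
  yangA η h j * h ^ (2 / yangJ j) * N * lam ^ (1 / (2 * yangJ j - 2))
    + yangB η j * N ^ (1 - 2 / yangJ j) * lam ^ (-(1 / (2 * yangJ j - 2)))

/-- A nonnegative quadratic: `N² ≤ 4ac`, `a > 0` give `aρ² - Nρ + c ≥ 0`. [folklore] -/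
theorem quad_nonneg {a c N ρ : ℝ} (ha : 0 < a) (h : N * N ≤ 4 * a * c) : 0 ≤ a * ρ ^ 2 - N * ρ + c := by
  nlinarith [sq_nonneg (2 * a * ρ - N)]

/-- `(X + Y)² ≥ X² + Y²` for `X, Y ≥ 0`, in root form. [folklore] -/
theorem le_add_of_sq_le {S X Y : ℝ} (hS : 0 ≤ S) (hX : 0 ≤ X) (hY : 0 ≤ Y) (h : S ^ 2 ≤ X ^ 2 + Y ^ 2) :
    S ≤ X + Y := by
  have h2 : S ^ 2 ≤ (X + Y) ^ 2 := by nlinarith [mul_nonneg hX hY]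
  exact (pow_le_pow_iff_left₀ hS (add_nonneg hX hY) two_ne_zero).1 h2

/-- `c_J² ≥ 2 · 2^{1/6} · α_J` where `α_J = 4(J-1)²/((2J-1)(4J-3))`, i.e. `2^{19/6} ≥ 2^{1+1/6}·4`.
[cite: Yang2024, Lemma 2.5 (proof)] -/
theorem yangCJ_sq_ge {J : ℝ} (hJ : 4 ≤ J) {t : ℝ} (ht : t ≤ (2 : ℝ) ^ (1 / 6 : ℝ)) :
    2 * t * (4 * (J - 1) ^ 2 / ((2 * J - 1) * (4 * J - 3))) ≤ yangCJ J ^ 2 := by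
  have hden : 0 < (2 * J - 1) * (4 * J - 3) := by nlinarith
  have hcJ2 : yangCJ J ^ 2 = (2 : ℝ) ^ (19 / 6 : ℝ) * (J - 1) ^ 2 / ((2 * J - 1) * (4 * J - 3)) := by
    rw [yangCJ, div_pow, mul_pow, Real.sq_sqrt hden.le, ← Real.rpow_natCast,
      ← Real.rpow_mul (by norm_num)]
    norm_num
  rw [hcJ2]
  have h196 : (2 : ℝ) ^ (19 / 6 : ℝ) = 8 * (2 : ℝ) ^ (1 / 6 : ℝ) := by
    rw [show (19 / 6 : ℝ) = 3 + 1 / 6 by norm_num, Real.rpow_add (by norm_num)]; norm_num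
  rw [h196]
  have hJ1 : 0 ≤ (J - 1) ^ 2 / ((2 * J - 1) * (4 * J - 3)) := by positivity
  have e : 2 * t * (4 * (J - 1) ^ 2 / ((2 * J - 1) * (4 * J - 3)))
      = (8 * t) * ((J - 1) ^ 2 / ((2 * J - 1) * (4 * J - 3))) := by ring
  rw [e, show 8 * (2 : ℝ) ^ (1 / 6 : ℝ) * (J - 1) ^ 2 / ((2 * J - 1) * (4 * J - 3))
      = (8 * (2 : ℝ) ^ (1 / 6 : ℝ)) * ((J - 1) ^ 2 / ((2 * J - 1) * (4 * J - 3))) by ring]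
  exact mul_le_mul_of_nonneg_right (by linarith) hJ1

/-- `d_J² = 2 β_J` where `β_J = 4(J-1)²/((2J-3)(4J-5))`. [cite: Yang2024, Lemma 2.5 (proof)] -/
theorem yangDJ_sq {J : ℝ} (hJ : 4 ≤ J) :
    yangDJ J ^ 2 = 2 * (4 * (J - 1) ^ 2 / ((2 * J - 3) * (4 * J - 5))) := by
  have hden : 0 < (2 * J - 3) * (4 * J - 5) := by nlinarith
  rw [yangDJ, div_pow, mul_pow, Real.sq_sqrt hden.le, ← Real.rpow_natCast,
    ← Real.rpow_mul (by norm_num)]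
  norm_num
  ring

/-- `α_J = 1/((1+s)(2+s))` and `β_J = 1/((1-s)(2-s))` for `s = 1/(2J-2)`. [folklore] -/
theorem alpha_eq {J : ℝ} (hJ : 4 ≤ J) :
    1 / ((1 + 1 / (2 * J - 2)) * (2 + 1 / (2 * J - 2))) = 4 * (J - 1) ^ 2 / ((2 * J - 1) * (4 * J - 3)) := by
  have h2 : (2 : ℝ) * J - 1 ≠ 0 := by linarith
  have h3 : (4 : ℝ) * J - 3 ≠ 0 := by linarith
  have h0 : (J - 1) ≠ 0 := by linarith
  have h1 : (2 : ℝ) * J - 2 ≠ 0 := by linarith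
  have e1 : 1 + 1 / (2 * J - 2) = (2 * J - 1) / (2 * (J - 1)) := by
    field_simp; ring
  have e2 : 2 + 1 / (2 * J - 2) = (4 * J - 3) / (2 * (J - 1)) := by
    field_simp; ring
  rw [e1, e2]
  field_simp
  ring

/-- `β_J = 1/((1-s)(2-s))` for `s = 1/(2J-2)`. [folklore] -/
theorem beta_eq {J : ℝ} (hJ : 4 ≤ J) :
    1 / ((1 - 1 / (2 * J - 2)) * (2 - 1 / (2 * J - 2))) = 4 * (J - 1) ^ 2 / ((2 * J - 3) * (4 * J - 5)) := by
  have h2 : (2 : ℝ) * J - 3 ≠ 0 := by linarith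
  have h3 : (4 : ℝ) * J - 5 ≠ 0 := by linarith
  have h0 : (J - 1) ≠ 0 := by linarith
  have h1 : (2 : ℝ) * J - 2 ≠ 0 := by linarith
  have e1 : 1 - 1 / (2 * J - 2) = (2 * J - 3) / (2 * (J - 1)) := by
    field_simp; ring
  have e2 : 2 - 1 / (2 * J - 2) = (4 * J - 5) / (2 * (J - 1)) := by
    field_simp; ring
  rw [e1, e2]
  field_simp
  ring

section step

variable {η h : ℝ}

/-- `yangKRHS` is nonnegative (`j ≥ 3`, `N ≥ 0`, `λ > 0`). [folklore] -/
theorem yangKRHS_nonneg (hη : 0 < η) (hh : 1 ≤ h) {j : ℕ} (hj : 3 ≤ j) {N lam : ℝ} (hN : 0 ≤ N)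
    (hlam : 0 < lam) : 0 ≤ yangKRHS η h j N lam := by
  unfold yangKRHS
  have := yangA_pos hη hh j hj
  have := yangB_pos hη j hj
  have : 0 < h := by linarith
  positivity

/-- The order-`j+1` right-hand side in terms of the roots `ρ = λ^{1/(4J-2)}`, `θ = h^{1/J}`,
`ν = N^{1/J}` (`J = 2^{j-1}`): `A_{j+1} θ N ρ + B_{j+1} ν^{J-1} ρ⁻¹`. [folklore] -/
theorem yangKRHS_succ_eq (η h : ℝ) {j : ℕ} (hj : 3 ≤ j) {N lam : ℝ} (hN : 0 < N)
    (hlam : 0 < lam) :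
    yangKRHS η h (j + 1) N lam
      = yangA η h (j + 1) * h ^ (1 / yangJ j) * N * lam ^ (1 / (4 * yangJ j - 2))
        + yangB η (j + 1) * (N ^ (1 / yangJ j)) ^ (2 ^ (j - 1) - 1) * (lam ^ (1 / (4 * yangJ j - 2)))⁻¹ := by
  set J := yangJ j with hJ
  have hJ0 : 0 < J := yangJ_pos j
  have hJnJ : ((2 ^ (j - 1) : ℕ) : ℝ) = J := by rw [hJ, yangJ]; push_cast; ring
  have hν0 : 0 < N ^ (1 / J) := Real.rpow_pos_of_pos hN _
  unfold yangKRHS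
  rw [show yangJ (j + 1) = 2 * J from yangJ_succ j (by omega)]
  have e1 : (2 : ℝ) / (2 * J) = 1 / J := by rw [div_eq_div_iff (by positivity) hJ0.ne']; ring
  have e2 : (2 : ℝ) * (2 * J) - 2 = 4 * J - 2 := by ring
  have e4 : N ^ (1 - 1 / J) = (N ^ (1 / J)) ^ (2 ^ (j - 1) - 1) := by
    rw [Real.rpow_sub hN, Real.rpow_one, div_eq_iff hν0.ne', ← pow_succ,
      Nat.sub_add_cancel Nat.one_le_two_pow, ← Real.rpow_natCast, ← Real.rpow_mul hN.le, hJnJ,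
      one_div_mul_cancel hJ0.ne', Real.rpow_one]
  rw [e1, e2, e4, Real.rpow_neg hlam.le]

/-- **Step 1 of the induction: the differenced sums.** Under the order-`j` hypothesis `IH`, for a
family of order `j + 1` with `λ ≤ D^{(j+1)} ≤ hλ` and every integer `r ≥ 1`:
`‖∑_{a<n≤b-r} e(D₀(n+r) - D₀(n))‖ ≤ A_j h^{2/J} N (rλ)^s + B_j N^{1-2/J} (rλ)^{-s}`,
`s = 1/(2J-2)`. [cite: Yang2024, Lemma 2.5 (proof)] -/
theorem kth_diff (hη : 0 < η) (hh : 1 ≤ h) {j : ℕ} (hj : 3 ≤ j)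
    (IH : ∀ ⦃a b : ℤ⦄ ⦃lam : ℝ⦄ ⦃D : ℕ → ℝ → ℝ⦄, a < b → 0 < lam → DerivFamily D a b j →
      (∀ y ∈ Set.Icc (a : ℝ) b, lam ≤ D j y ∧ D j y ≤ h * lam) →
      ‖∑ n ∈ Finset.Ioc a b, e (D 0 n)‖ ≤ yangKRHS η h j ((b : ℝ) - a) lam)
    {a b : ℤ} {lam : ℝ} {D : ℕ → ℝ → ℝ} (hab : a < b) (hlam : 0 < lam)
    (hD : DerivFamily D a b (j + 1))
    (hbd : ∀ y ∈ Set.Icc (a : ℝ) b, lam ≤ D (j + 1) y ∧ D (j + 1) y ≤ h * lam) {r : ℕ} (hr : 1 ≤ r) :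
    ‖∑ n ∈ Finset.Ioc a (b - r), e (D 0 ((n + r : ℤ)) - D 0 n)‖
      ≤ yangA η h j * h ^ (2 / yangJ j) * ((b : ℝ) - a) * ((r : ℝ) * lam) ^ (1 / (2 * yangJ j - 2))
        + yangB η j * ((b : ℝ) - a) ^ (1 - 2 / yangJ j) * ((r : ℝ) * lam) ^ (-(1 / (2 * yangJ j - 2))) := by
  have hh0 : 0 < h := by linarith
  have hA0 := yangA_pos hη hh j hj
  have hB0 := yangB_pos hη j hj
  have hJ4 := four_le_yangJ hj
  have hJ0 : 0 < yangJ j := by linarith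
  have hrpos : (0 : ℝ) < r := by exact_mod_cast hr
  have hrl : 0 < (r : ℝ) * lam := by positivity
  have hN0 : 0 < (b : ℝ) - a := by
    have : ((a : ℤ) : ℝ) < b := by exact_mod_cast hab
    linarith
  rcases le_or_gt (b - r) a with hle | hlt
  · rw [Finset.Ioc_eq_empty (by omega), sum_empty, norm_zero]; positivity
  -- the differenced family of order `j`
  set D' : ℕ → ℝ → ℝ := fun i y => D i (y + r) - D i y with hD'
  have e1 : (((b - (r : ℤ) : ℤ)) : ℝ) = (b : ℝ) - r := by push_cast; ring
  have hD'fam : DerivFamily D' a (((b - (r : ℤ) : ℤ)) : ℝ) j := by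
    rw [e1]; exact (hD.mono (Nat.le_succ j)).diff (d := (r : ℝ)) hrpos.le
  have hD'bd : ∀ y ∈ Set.Icc (a : ℝ) (((b - (r : ℤ) : ℤ)) : ℝ),
      (r : ℝ) * lam ≤ D' j y ∧ D' j y ≤ h * ((r : ℝ) * lam) := by
    intro y hy
    rw [e1] at hy
    exact hD.diff_bound hrpos hbd y hy
  have hIH := IH hlt hrl hD'fam hD'bd
  have hsum : ∑ n ∈ Finset.Ioc a (b - r), e (D 0 ((n + r : ℤ)) - D 0 n)
      = ∑ n ∈ Finset.Ioc a (b - (r : ℤ)), e (D' 0 n) := by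
    refine Finset.sum_congr rfl fun n _ => ?_
    have : (((n + (r : ℤ) : ℤ)) : ℝ) = (n : ℝ) + (r : ℝ) := by push_cast; ring
    rw [this]
  rw [hsum]
  refine hIH.trans ?_
  unfold yangKRHS
  rw [e1]
  have hNr0 : 0 ≤ (b : ℝ) - r - a := by
    have : ((a : ℤ) : ℝ) < ((b - (r : ℤ) : ℤ) : ℝ) := by exact_mod_cast hlt
    rw [e1] at this; linarith
  have hNr : (b : ℝ) - r - a ≤ (b : ℝ) - a := by linarith
  have hexp0 : 0 ≤ 1 - 2 / yangJ j := by rw [sub_nonneg, div_le_one hJ0]; linarith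
  have hpow1 : ((b : ℝ) - r - a) ^ (1 - 2 / yangJ j) ≤ ((b : ℝ) - a) ^ (1 - 2 / yangJ j) :=
    Real.rpow_le_rpow hNr0 hNr hexp0
  gcongr

/-- **Step 2 of the induction: the weighted sum** of the differenced-sum bounds with the weights
`1 - r/q`, through `∑ (1 - r/q) r^{±s}`. [cite: Yang2024, Lemma 2.5 (proof)] -/
theorem kth_weighted {M₁ M₂ lam s : ℝ} (hM₁ : 0 ≤ M₁) (hM₂ : 0 ≤ M₂) (hlam : 0 < lam) (hs0 : 0 < s)
    (hs1 : s < 1) {q : ℕ} (hq : 1 ≤ q) {F : ℕ → ℝ}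
    (hF : ∀ r : ℕ, 1 ≤ r → F r ≤ M₁ * ((r : ℝ) * lam) ^ s + M₂ * ((r : ℝ) * lam) ^ (-s)) :
    ∑ r ∈ Finset.Ico 1 q, (1 - (r : ℝ) / q) * F r
      ≤ M₁ * lam ^ s * ((q : ℝ) ^ (1 + s) / ((1 + s) * (2 + s)))
        + M₂ * lam ^ (-s) * ((q : ℝ) ^ (1 - s) / ((1 - s) * (2 - s))) := by
  have hqpos : (0 : ℝ) < q := by exact_mod_cast hq
  have hterm : ∀ r ∈ Finset.Ico 1 q, (1 - (r : ℝ) / q) * F r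
      ≤ M₁ * lam ^ s * ((1 - (r : ℝ) / q) * (r : ℝ) ^ s)
        + M₂ * lam ^ (-s) * ((1 - (r : ℝ) / q) * (r : ℝ) ^ (-s)) := by
    intro r hr
    rw [Finset.mem_Ico] at hr
    have hw : 0 ≤ 1 - (r : ℝ) / q := by
      rw [sub_nonneg, div_le_one hqpos]; exact_mod_cast hr.2.le
    have hb := hF r hr.1
    have hr0 : (0 : ℝ) ≤ r := Nat.cast_nonneg r
    rw [Real.mul_rpow hr0 hlam.le, Real.mul_rpow hr0 hlam.le] at hb
    calc (1 - (r : ℝ) / q) * F r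
        ≤ (1 - (r : ℝ) / q) * (M₁ * ((r : ℝ) ^ s * lam ^ s) + M₂ * ((r : ℝ) ^ (-s) * lam ^ (-s))) :=
          mul_le_mul_of_nonneg_left hb hw
      _ = _ := by ring
  refine (Finset.sum_le_sum hterm).trans ?_
  rw [Finset.sum_add_distrib, ← Finset.mul_sum, ← Finset.mul_sum]
  have d1 := dhir_rpow_pos hs0 (by linarith) q hq
  have d2 := dhir_rpow_neg (s := -s) (by linarith) (by linarith) q hq
  have e2 : (q : ℝ) ^ (1 + -s) / ((1 + -s) * (2 + -s)) = (q : ℝ) ^ (1 - s) / ((1 - s) * (2 - s)) := by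
    ring_nf
  rw [e2] at d2
  exact add_le_add (mul_le_mul_of_nonneg_left d1 (by positivity)) (mul_le_mul_of_nonneg_left d2 (by positivity))

/-- **Step 3 of the induction: the bound `1 + q/N ≤ δ_j²`** in the range `N ≥ 2337`, `λ ≥ λ₀`
(expressed through the roots: `x = ρ⁻²`, `q ≤ 2x`, `(νρ)^{2J} ≥ 1024/(9πη)`, `ν^J = N`).
[cite: Yang2024, Lemma 2.5 (proof)] -/
theorem kth_Dbound (hη : 0 < η) {J : ℝ} (hJ : 4 ≤ J) {Jn : ℕ} (hJnJ : (Jn : ℝ) = J) (hJn4 : 4 ≤ Jn)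
    {N ν ρ q : ℝ} (hN : 2337 ≤ N) (hν0 : 0 < ν) (hρ0 : 0 < ρ) (hνpow : ν ^ Jn = N)
    (hR : 1024 / (9 * π * η) ≤ (ν * ρ) ^ (2 * Jn)) (hq : q ≤ 2 * (ρ ^ 2)⁻¹) :
    1 + q / N ≤ yangDeltaJ η J ^ 2 := by
  have hπ := Real.pi_pos
  have hJ0 : 0 < J := by linarith
  have hN0 : 0 < N := by linarith
  have hδsq : yangDeltaJ η J ^ 2 = 1 + 2 / (2337 : ℝ) ^ (1 - 2 / J) * (9 * π / 1024 * η) ^ (1 / J) := by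
    rw [yangDeltaJ, Real.sq_sqrt (by positivity)]
  rw [hδsq, add_le_add_iff_left]
  set G : ℝ := 9 * π / 1024 * η with hG
  have hG0 : 0 < G := by positivity
  set x : ℝ := (ρ ^ 2)⁻¹ with hx
  have hx0 : 0 < x := by positivity
  -- `x ≤ G^{1/J} ν²` from `(νρ)^{2Jn} ≥ 1/G`
  have hxle : x ≤ G ^ (1 / J) * ν ^ 2 := by
    have eG : (G ^ (1 / J)) ^ Jn = G := by
      rw [← Real.rpow_natCast, ← Real.rpow_mul hG0.le, hJnJ, one_div_mul_cancel hJ0.ne', Real.rpow_one]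
    have h1 : 1 ≤ G * (ν * ρ) ^ (2 * Jn) := by
      have : 1 / G = 1024 / (9 * π * η) := by rw [hG]; field_simp
      rw [← this] at hR
      rw [one_div, inv_le_iff_one_le_mul₀ hG0] at hR
      rwa [mul_comm] at hR
    have h2 : x ^ Jn ≤ (G ^ (1 / J) * ν ^ 2) ^ Jn := by
      rw [mul_pow, eG, hx, inv_pow, ← pow_mul, inv_le_iff_one_le_mul₀ (by positivity)]
      calc (1 : ℝ) ≤ G * (ν * ρ) ^ (2 * Jn) := h1
        _ = G * (ν ^ 2) ^ Jn * ρ ^ (2 * Jn) := by rw [mul_pow, pow_mul]; ring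
    exact (pow_le_pow_iff_left₀ hx0.le (by positivity) (by omega)).1 h2
  -- `ν^{Jn-2} = N^{1-2/J} ≥ 2337^{1-2/J}`
  have hνJ2 : N = ν ^ (Jn - 2) * ν ^ 2 := by rw [← pow_add, Nat.sub_add_cancel (by omega), hνpow]
  have hexp : 0 ≤ 1 - 2 / J := by rw [sub_nonneg, div_le_one hJ0]; linarith
  have hνpow' : (2337 : ℝ) ^ (1 - 2 / J) ≤ ν ^ (Jn - 2) := by
    have e1 : ν ^ (Jn - 2) = N ^ (1 - 2 / J) := by
      have hνN : ν = N ^ (1 / J) := by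
        rw [← hνpow, ← Real.rpow_natCast, ← Real.rpow_mul hν0.le, hJnJ, mul_one_div_cancel hJ0.ne',
          Real.rpow_one]
      rw [hνN, ← Real.rpow_natCast, ← Real.rpow_mul hN0.le]
      congr 1
      rw [Nat.cast_sub (by omega)]; push_cast; rw [hJnJ]; field_simp
    rw [e1]
    exact Real.rpow_le_rpow (by norm_num) hN hexp
  have h2337 : (0 : ℝ) < (2337 : ℝ) ^ (1 - 2 / J) := Real.rpow_pos_of_pos (by norm_num) _
  calc q / N ≤ 2 * (G ^ (1 / J) * ν ^ 2) / N := by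
        apply div_le_div_of_nonneg_right _ hN0.le; linarith
    _ = 2 * G ^ (1 / J) / ν ^ (Jn - 2) := by rw [hνJ2]; field_simp
    _ ≤ 2 * G ^ (1 / J) / (2337 : ℝ) ^ (1 - 2 / J) :=
        div_le_div_of_nonneg_left (mul_nonneg zero_le_two (Real.rpow_nonneg hG0.le _)) h2337 hνpow'
    _ = 2 / (2337 : ℝ) ^ (1 - 2 / J) * G ^ (1 / J) := by ring

/-- **Step 4 of the induction: the final algebra.** [cite: Yang2024, Lemma 2.5 (proof)] -/
theorem kth_algebra {S N q W ρ δ α β M₁ M₂ t A θ cJ dJ B νp X Y : ℝ}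
    (hS0 : 0 ≤ S) (hN0 : 0 < N) (hq1 : 1 ≤ q) (hρ0 : 0 < ρ) (hδ0 : 0 ≤ δ) (hα : 0 ≤ α) (hβ : 0 ≤ β)
    (ht : 0 ≤ t) (hA : 0 ≤ A) (hθ : 0 ≤ θ) (hcJ : 0 ≤ cJ) (hB : 0 ≤ B) (hνp : 0 ≤ νp)
    (hM₂0 : 0 ≤ M₂) (hW0 : 0 ≤ W) (hdJ : 0 ≤ dJ)
    (hAP : S ^ 2 ≤ (N - 1 + q) * (N / q + 2 / q * W))
    (hW2 : 2 / q * W ≤ 2 * α * M₁ * (t * ρ ^ 2) + 2 * β * M₂ * (ρ ^ 2)⁻¹)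
    (hqinv : 1 / q ≤ ρ ^ 2) (hD : 1 + q / N ≤ δ ^ 2)
    (hM₁ : M₁ = A * θ ^ 2 * N) (hM₂N : N * M₂ = B * νp ^ 2)
    (hcJsq : 2 * t * α ≤ cJ ^ 2) (hdJsq : dJ ^ 2 = 2 * β)
    (hX : X = δ * (θ⁻¹ + cJ * Real.sqrt A) * θ * N * ρ) (hY : Y = δ * dJ * Real.sqrt B * νp * ρ⁻¹)
    (hθ0 : 0 < θ) :
    S ≤ X + Y := by
  have hX0 : 0 ≤ X := by
    rw [hX]
    exact mul_nonneg (mul_nonneg (mul_nonneg (mul_nonneg hδ0 (add_nonneg (inv_nonneg.2 hθ0.le)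
      (mul_nonneg hcJ (Real.sqrt_nonneg _)))) hθ) hN0.le) hρ0.le
  have hY0 : 0 ≤ Y := by
    rw [hY]
    exact mul_nonneg (mul_nonneg (mul_nonneg (mul_nonneg hδ0 hdJ) (Real.sqrt_nonneg _)) hνp)
      (inv_nonneg.2 hρ0.le)
  refine le_add_of_sq_le hS0 hX0 hY0 ?_
  -- `S² ≤ δ² N (Nρ² + 2αM₁tρ² + 2βM₂ρ⁻²)`
  have hq0 : 0 < q := by linarith
  have hF2 : N / q + 2 / q * W ≤ N * ρ ^ 2 + 2 * α * M₁ * (t * ρ ^ 2) + 2 * β * M₂ * (ρ ^ 2)⁻¹ := by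
    have h2 : N / q ≤ N * ρ ^ 2 := by
      rw [div_eq_mul_one_div]; exact mul_le_mul_of_nonneg_left hqinv hN0.le
    linarith
  have hM₁0 : 0 ≤ M₁ := by rw [hM₁]; positivity
  have hF1 : N - 1 + q ≤ N * (1 + q / N) := by
    rw [mul_add, mul_one, mul_div_cancel₀ _ hN0.ne']; linarith
  have hlow : 0 ≤ N / q + 2 / q * W := by positivity
  have hS2 : S ^ 2 ≤ δ ^ 2 * (N * (N * ρ ^ 2 + 2 * α * M₁ * (t * ρ ^ 2) + 2 * β * M₂ * (ρ ^ 2)⁻¹)) := by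
    calc S ^ 2 ≤ (N - 1 + q) * (N / q + 2 / q * W) := hAP
      _ ≤ (N * (1 + q / N)) * (N * ρ ^ 2 + 2 * α * M₁ * (t * ρ ^ 2) + 2 * β * M₂ * (ρ ^ 2)⁻¹) :=
          mul_le_mul hF1 hF2 hlow (by positivity)
      _ = (1 + q / N) * (N * (N * ρ ^ 2 + 2 * α * M₁ * (t * ρ ^ 2) + 2 * β * M₂ * (ρ ^ 2)⁻¹)) := by ring
      _ ≤ _ := mul_le_mul_of_nonneg_right hD (by positivity)
  -- `X² ≥ δ²N²ρ²(1 + 2tαAθ²)`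
  have hsA : Real.sqrt A ^ 2 = A := Real.sq_sqrt hA
  have hsB : Real.sqrt B ^ 2 = B := Real.sq_sqrt hB
  have hXsq : δ ^ 2 * (N * (N * ρ ^ 2 + 2 * α * M₁ * (t * ρ ^ 2))) ≤ X ^ 2 := by
    have eX : X = δ * ρ * N * (1 + cJ * Real.sqrt A * θ) := by rw [hX]; field_simp
    rw [eX, hM₁]
    have hct : 0 ≤ cJ * Real.sqrt A * θ := by positivity
    have h1 : 1 + 2 * t * α * A * θ ^ 2 ≤ (1 + cJ * Real.sqrt A * θ) ^ 2 := by
      have h2 : 2 * t * α * A * θ ^ 2 ≤ cJ ^ 2 * A * θ ^ 2 := by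
        have hAθ : 0 ≤ A * θ ^ 2 := mul_nonneg hA (sq_nonneg _)
        calc 2 * t * α * A * θ ^ 2 = (2 * t * α) * (A * θ ^ 2) := by ring
          _ ≤ cJ ^ 2 * (A * θ ^ 2) := mul_le_mul_of_nonneg_right hcJsq hAθ
          _ = cJ ^ 2 * A * θ ^ 2 := by ring
      calc 1 + 2 * t * α * A * θ ^ 2 ≤ 1 + cJ ^ 2 * A * θ ^ 2 := by linarith
        _ ≤ 1 + 2 * (cJ * Real.sqrt A * θ) + (cJ * Real.sqrt A * θ) ^ 2 := by
            rw [mul_pow, mul_pow, hsA]; linarith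
        _ = (1 + cJ * Real.sqrt A * θ) ^ 2 := by ring
    have h0 : 0 ≤ (δ * ρ * N) ^ 2 := sq_nonneg _
    calc δ ^ 2 * (N * (N * ρ ^ 2 + 2 * α * (A * θ ^ 2 * N) * (t * ρ ^ 2)))
        = (δ * ρ * N) ^ 2 * (1 + 2 * t * α * A * θ ^ 2) := by ring
      _ ≤ (δ * ρ * N) ^ 2 * (1 + cJ * Real.sqrt A * θ) ^ 2 := mul_le_mul_of_nonneg_left h1 h0
      _ = (δ * ρ * N * (1 + cJ * Real.sqrt A * θ)) ^ 2 := by ring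
  -- `Y² = δ² N · 2βM₂ρ⁻²`
  have hYsq : δ ^ 2 * (N * (2 * β * M₂ * (ρ ^ 2)⁻¹)) = Y ^ 2 := by
    rw [hY]
    calc δ ^ 2 * (N * (2 * β * M₂ * (ρ ^ 2)⁻¹)) = δ ^ 2 * (2 * β) * (N * M₂) * (ρ ^ 2)⁻¹ := by ring
      _ = δ ^ 2 * dJ ^ 2 * (B * νp ^ 2) * (ρ ^ 2)⁻¹ := by rw [hdJsq, hM₂N]
      _ = δ ^ 2 * dJ ^ 2 * (Real.sqrt B ^ 2 * νp ^ 2) * (ρ ^ 2)⁻¹ := by rw [hsB]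
      _ = (δ * dJ * Real.sqrt B * νp * ρ⁻¹) ^ 2 := by ring
  calc S ^ 2 ≤ δ ^ 2 * (N * (N * ρ ^ 2 + 2 * α * M₁ * (t * ρ ^ 2) + 2 * β * M₂ * (ρ ^ 2)⁻¹)) := hS2
    _ = δ ^ 2 * (N * (N * ρ ^ 2 + 2 * α * M₁ * (t * ρ ^ 2))) + δ ^ 2 * (N * (2 * β * M₂ * (ρ ^ 2)⁻¹)) := by
        ring
    _ ≤ X ^ 2 + Y ^ 2 := by rw [← hYsq]; linarith [hXsq]

set_option maxHeartbeats 400000 in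
/-- **The main range of the induction step, as an inequality between real numbers**: given the
`A`-process bound `S² ≤ (N - 1 + q)(N/q + (2/q)W)`, the weighted differenced-sum bound for `W`,
`q ∈ (x, 2x]` with `x = λ^{-1/(2J-1)}`, `N > 2336`, `λ < 1` and `λ > λ₀` (as
`(N^{1/J}λ^{1/(4J-2)})^{2J} ≥ 1024/(9πη)`), conclude `S ≤ A_{j+1}θNρ + B_{j+1}ν^{J-1}ρ⁻¹`.
[cite: Yang2024, Lemma 2.5 (proof)] -/
theorem kth_main_real (hη : 0 < η) (hh : 1 ≤ h) {j : ℕ} (hj : 3 ≤ j) {N lam S W : ℝ} {q : ℕ}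
    (hN2337 : 2337 ≤ N) (hlam : 0 < lam) (hlam1 : lam < 1) (hS0 : 0 ≤ S) (hW0 : 0 ≤ W) (hq1 : 1 ≤ q)
    (hqx : ((lam ^ (1 / (4 * yangJ j - 2))) ^ 2)⁻¹ < q)
    (hq2x : (q : ℝ) ≤ 2 * ((lam ^ (1 / (4 * yangJ j - 2))) ^ 2)⁻¹)
    (hR : 1024 / (9 * π * η) ≤ (N ^ (1 / yangJ j) * lam ^ (1 / (4 * yangJ j - 2))) ^ (2 * 2 ^ (j - 1)))
    (hW : W ≤ yangA η h j * (h ^ (1 / yangJ j)) ^ 2 * N * lam ^ (1 / (2 * yangJ j - 2))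
        * ((q : ℝ) ^ (1 + 1 / (2 * yangJ j - 2)) / ((1 + 1 / (2 * yangJ j - 2)) * (2 + 1 / (2 * yangJ j - 2))))
      + yangB η j * N ^ (1 - 2 / yangJ j) * lam ^ (-(1 / (2 * yangJ j - 2)))
        * ((q : ℝ) ^ (1 - 1 / (2 * yangJ j - 2)) / ((1 - 1 / (2 * yangJ j - 2)) * (2 - 1 / (2 * yangJ j - 2)))))
    (hAP : S ^ 2 ≤ (N - 1 + q) * (N / q + 2 / q * W)) :
    S ≤ yangA η h (j + 1) * h ^ (1 / yangJ j) * N * lam ^ (1 / (4 * yangJ j - 2))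
      + yangB η (j + 1) * (N ^ (1 / yangJ j)) ^ (2 ^ (j - 1) - 1) * (lam ^ (1 / (4 * yangJ j - 2)))⁻¹ := by
  have hπ := Real.pi_pos
  have hh0 : 0 < h := by linarith
  have hN0 : 0 < N := by linarith
  set J : ℝ := yangJ j with hJdef
  have hJ4 : 4 ≤ J := four_le_yangJ hj
  have hJ0 : 0 < J := by linarith
  set Jn : ℕ := 2 ^ (j - 1) with hJn
  have hJnJ : (Jn : ℝ) = J := by rw [hJn, hJdef, yangJ]; push_cast; ring
  have hJn4 : 4 ≤ Jn := by
    rw [hJn]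
    calc 4 = 2 ^ 2 := by norm_num
      _ ≤ 2 ^ (j - 1) := Nat.pow_le_pow_right (by norm_num) (by omega)
  clear_value Jn J
  have hden1 : 0 < (2 * J - 1) * (4 * J - 3) := by nlinarith
  have hden2 : 0 < (2 * J - 3) * (4 * J - 5) := by nlinarith
  have hJ1 : (J : ℝ) - 1 ≠ 0 := by linarith
  -- the exponent `s`
  set s : ℝ := 1 / (2 * J - 2) with hs
  have h2J2 : (2 : ℝ) * J - 2 ≠ 0 := by linarith
  have hs0 : 0 < s := by rw [hs]; apply one_div_pos.2; linarith
  have hs6 : s ≤ 1 / 6 := by rw [hs]; apply one_div_le_one_div_of_le (by norm_num); linarith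
  have hs1 : s < 1 := by linarith
  have h2s : (2 : ℝ) ^ s ≤ (2 : ℝ) ^ (1 / 6 : ℝ) := Real.rpow_le_rpow_of_exponent_le (by norm_num) hs6
  have h2s0 : 0 ≤ (2 : ℝ) ^ s := Real.rpow_nonneg (by norm_num) _
  clear_value s
  -- the constants (made opaque)
  have hA0 : 0 < yangA η h j := yangA_pos hη hh j hj
  have hB0 : 0 < yangB η j := yangB_pos hη j hj
  have hδ0 : 0 < yangDeltaJ η J := yangDeltaJ_pos hη.le J
  have hcJ0 : 0 < yangCJ J := yangCJ_pos hJ4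
  have hcJsq : 2 * (2 : ℝ) ^ s * (4 * (J - 1) ^ 2 / ((2 * J - 1) * (4 * J - 3))) ≤ yangCJ J ^ 2 :=
    yangCJ_sq_ge hJ4 h2s
  have hdJsq : yangDJ J ^ 2 = 2 * (4 * (J - 1) ^ 2 / ((2 * J - 3) * (4 * J - 5))) := yangDJ_sq hJ4
  have hdJ0 : 0 ≤ yangDJ J := (yangDJ_pos hJ4).le
  have hA' : yangA η h (j + 1) = yangDeltaJ η J * (h ^ (-(1 / J)) + yangCJ J * Real.sqrt (yangA η h j)) := by
    have := yangA_succ η h hj; rwa [← hJdef] at this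
  have hB' : yangB η (j + 1) = yangDeltaJ η J * yangDJ J * Real.sqrt (yangB η j) := by
    have := yangB_succ η hj; rwa [← hJdef] at this
  have hθinv : h ^ (-(1 / J)) = (h ^ (1 / J))⁻¹ := Real.rpow_neg hh0.le _
  rw [hθinv] at hA'
  generalize yangA η h j = A at hA0 hA' hW
  generalize yangB η j = B at hB0 hB' hW
  generalize yangCJ J = cJ at hcJ0 hcJsq hA'
  generalize yangDJ J = dJ at hdJsq hdJ0 hB'
  generalize yangA η h (j + 1) = A' at hA' ⊢
  generalize yangB η (j + 1) = B' at hB' ⊢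
  -- the roots (made opaque)
  have hρ0 : 0 < lam ^ (1 / (4 * J - 2)) := Real.rpow_pos_of_pos hlam _
  have hθ0 : 0 < h ^ (1 / J) := Real.rpow_pos_of_pos hh0 _
  have hν0 : 0 < N ^ (1 / J) := Real.rpow_pos_of_pos hN0 _
  have h4J2 : (((4 * Jn - 2 : ℕ)) : ℝ) = 4 * J - 2 := by
    rw [Nat.cast_sub (by omega)]; push_cast; rw [hJnJ]
  have h4J2' : (4 : ℝ) * J - 2 ≠ 0 := by linarith
  have hρpow : (lam ^ (1 / (4 * J - 2))) ^ (4 * Jn - 2) = lam := by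
    rw [← Real.rpow_natCast, ← Real.rpow_mul hlam.le, h4J2, one_div_mul_cancel h4J2', Real.rpow_one]
  have hνpow : (N ^ (1 / J)) ^ Jn = N := by
    rw [← Real.rpow_natCast, ← Real.rpow_mul hN0.le, hJnJ, one_div_mul_cancel hJ0.ne', Real.rpow_one]
  have hN2J' : N ^ (1 - 2 / J) = (N ^ (1 / J)) ^ (Jn - 2) := by
    rw [← Real.rpow_natCast, ← Real.rpow_mul hN0.le]
    congr 1
    rw [Nat.cast_sub (by omega)]; push_cast; rw [hJnJ]; field_simp
  have hρ1 : lam ^ (1 / (4 * J - 2)) ≤ 1 :=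
    Real.rpow_le_one hlam.le hlam1.le (div_nonneg zero_le_one (by linarith))
  rw [hN2J'] at hW
  generalize lam ^ (1 / (4 * J - 2)) = ρ at hρ0 hρpow hρ1 hqx hq2x hR ⊢
  generalize h ^ (1 / J) = θ at hθ0 hA' hW ⊢
  generalize N ^ (1 / J) = ν at hν0 hνpow hR hW ⊢
  have hνp0 : 0 ≤ ν ^ (Jn - 1) := pow_nonneg hν0.le _
  have hqpos : (0 : ℝ) < q := by exact_mod_cast hq1
  -- `x = ρ⁻²`, `(qλ)^{±s}` and `1/q` through `ρ`
  set x : ℝ := (ρ ^ 2)⁻¹ with hx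
  have hx0 : 0 < x := by positivity
  have hxlam : x * lam = ρ ^ (4 * Jn - 4) := by
    rw [hx, ← hρpow, show 4 * Jn - 2 = (4 * Jn - 4) + 2 by omega, pow_add]; field_simp
  have h4J4 : (((4 * Jn - 4 : ℕ)) : ℝ) * s = 2 := by
    rw [Nat.cast_sub (by omega), hs]; push_cast; rw [hJnJ]; field_simp; ring
  have hxlam_s : (x * lam) ^ s = ρ ^ 2 := by
    rw [hxlam, ← Real.rpow_natCast, ← Real.rpow_mul hρ0.le, h4J4, Real.rpow_two]
  have hxl0 : 0 < x * lam := by positivity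
  have hqlam_s : ((q : ℝ) * lam) ^ s ≤ (2 : ℝ) ^ s * ρ ^ 2 := by
    calc ((q : ℝ) * lam) ^ s ≤ (2 * (x * lam)) ^ s := by
          apply Real.rpow_le_rpow (by positivity) _ hs0.le
          have := mul_le_mul_of_nonneg_right hq2x hlam.le; linarith
      _ = (2 : ℝ) ^ s * ρ ^ 2 := by rw [Real.mul_rpow (by norm_num) hxl0.le, hxlam_s]
  have hqlam_negs : ((q : ℝ) * lam) ^ (-s) ≤ (ρ ^ 2)⁻¹ := by
    calc ((q : ℝ) * lam) ^ (-s) ≤ (x * lam) ^ (-s) := by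
          apply Real.rpow_le_rpow_of_nonpos hxl0 _ (by linarith)
          have := mul_le_mul_of_nonneg_right hqx.le hlam.le; linarith
      _ = (ρ ^ 2)⁻¹ := by rw [Real.rpow_neg hxl0.le, hxlam_s]
  have hq_inv : 1 / (q : ℝ) ≤ ρ ^ 2 := by
    rw [one_div_le hqpos (by positivity)]
    have : x ≤ q := hqx.le
    rwa [hx, ← one_div] at this
  clear_value x
  -- `α, β`
  set α : ℝ := 4 * (J - 1) ^ 2 / ((2 * J - 1) * (4 * J - 3)) with hα
  set β : ℝ := 4 * (J - 1) ^ 2 / ((2 * J - 3) * (4 * J - 5)) with hβ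
  have hα0 : 0 ≤ α := div_nonneg (mul_nonneg (by norm_num) (sq_nonneg _)) hden1.le
  have hβ0 : 0 ≤ β := div_nonneg (mul_nonneg (by norm_num) (sq_nonneg _)) hden2.le
  have hαs : 1 / ((1 + s) * (2 + s)) = α := by rw [hs, hα]; exact alpha_eq hJ4
  have hβs : 1 / ((1 - s) * (2 - s)) = β := by rw [hs, hβ]; exact beta_eq hJ4
  clear_value α β
  -- `2/q · W ≤ 2α M₁ (2^s ρ²) + 2β M₂ ρ⁻²`
  set M₁ : ℝ := A * θ ^ 2 * N with hM₁
  set M₂ : ℝ := B * ν ^ (Jn - 2) with hM₂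
  have hM₁0 : 0 ≤ M₁ := mul_nonneg (mul_nonneg hA0.le (sq_nonneg _)) hN0.le
  have hM₂0 : 0 ≤ M₂ := mul_nonneg hB0.le (pow_nonneg hν0.le _)
  clear_value M₁ M₂
  have hW2 : 2 / q * W ≤ 2 * α * M₁ * ((2 : ℝ) ^ s * ρ ^ 2) + 2 * β * M₂ * (ρ ^ 2)⁻¹ := by
    have e1 : 2 / (q : ℝ) * (M₁ * lam ^ s * ((q : ℝ) ^ (1 + s) / ((1 + s) * (2 + s))))
        = 2 * α * M₁ * ((q : ℝ) * lam) ^ s := by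
      rw [div_eq_mul_one_div ((q : ℝ) ^ (1 + s)), hαs, Real.rpow_add hqpos, Real.rpow_one,
        Real.mul_rpow hqpos.le hlam.le]
      field_simp
    have e2 : 2 / (q : ℝ) * (M₂ * lam ^ (-s) * ((q : ℝ) ^ (1 - s) / ((1 - s) * (2 - s))))
        = 2 * β * M₂ * ((q : ℝ) * lam) ^ (-s) := by
      rw [div_eq_mul_one_div ((q : ℝ) ^ (1 - s)), hβs, Real.rpow_sub hqpos, Real.rpow_one,
        Real.mul_rpow hqpos.le hlam.le, Real.rpow_neg hqpos.le, Real.rpow_neg hlam.le]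
      field_simp
    have h1 : 2 / (q : ℝ) * W ≤ 2 * α * M₁ * ((q : ℝ) * lam) ^ s + 2 * β * M₂ * ((q : ℝ) * lam) ^ (-s) := by
      have h2q : (0:ℝ) ≤ 2 / q := by positivity
      have := mul_le_mul_of_nonneg_left hW h2q
      rw [mul_add, e1, e2] at this
      exact this
    have h3 := mul_le_mul_of_nonneg_left hqlam_s (by positivity : 0 ≤ 2 * α * M₁)
    have h4 := mul_le_mul_of_nonneg_left hqlam_negs (by positivity : 0 ≤ 2 * β * M₂)
    linarith
  -- `1 + q/N ≤ δ²`
  have hD2 : 1 + (q : ℝ) / N ≤ yangDeltaJ η J ^ 2 :=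
    kth_Dbound hη hJ4 hJnJ hJn4 hN2337 hν0 hρ0 hνpow hR (by rw [← hx]; exact hq2x)
  generalize yangDeltaJ η J = δ at hδ0 hA' hB' hD2
  -- `N M₂ = B (ν^{Jn-1})²`
  have hN2J : N * M₂ = B * (ν ^ (Jn - 1)) ^ 2 := by
    rw [hM₂]
    have : N * ν ^ (Jn - 2) = (ν ^ (Jn - 1)) ^ 2 := by
      rw [← hνpow, ← pow_add, ← pow_mul]; congr 1; omega
    calc N * (B * ν ^ (Jn - 2)) = B * (N * ν ^ (Jn - 2)) := by ring
      _ = B * (ν ^ (Jn - 1)) ^ 2 := by rw [this]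
  have hcJsq' : 2 * (2 : ℝ) ^ s * α ≤ cJ ^ 2 := hcJsq
  have hdJsq' : dJ ^ 2 = 2 * β := hdJsq
  have hq1' : (1 : ℝ) ≤ q := by exact_mod_cast hq1
  exact kth_algebra (X := A' * θ * N * ρ) (Y := B' * ν ^ (Jn - 1) * ρ⁻¹) hS0 hN0 hq1' hρ0 hδ0.le hα0 hβ0
    h2s0 hA0.le hθ0.le hcJ0.le hB0.le hνp0 hM₂0 hW0 hdJ0 hAP hW2 hq_inv hD2 hM₁ hN2J hcJsq' hdJsq'
    (by rw [hA']) (by rw [hB']) hθ0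

set_option maxHeartbeats 400000 in
/-- **The induction step of Yang's Lemma 2.5** (`A^{j-2}B(0,1) ⟹ A^{j-1}B(0,1)`): if the order-`j`
test holds with Yang's constants `A_j, B_j` for every phase family, then the order-`j+1` test
holds with `A_{j+1}, B_{j+1}`. [cite: Yang2024, Lemma 2.5 (proof)] -/
theorem kth_step (hη : 0 < η) (hh : 1 ≤ h) {j : ℕ} (hj : 3 ≤ j)
    (IH : ∀ ⦃a b : ℤ⦄ ⦃lam : ℝ⦄ ⦃D : ℕ → ℝ → ℝ⦄, a < b → 0 < lam → DerivFamily D a b j →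
      (∀ y ∈ Set.Icc (a : ℝ) b, lam ≤ D j y ∧ D j y ≤ h * lam) →
      ‖∑ n ∈ Finset.Ioc a b, e (D 0 n)‖ ≤ yangKRHS η h j ((b : ℝ) - a) lam)
    {a b : ℤ} {lam : ℝ} {D : ℕ → ℝ → ℝ} (hab : a < b) (hlam : 0 < lam)
    (hD : DerivFamily D a b (j + 1))
    (hbd : ∀ y ∈ Set.Icc (a : ℝ) b, lam ≤ D (j + 1) y ∧ D (j + 1) y ≤ h * lam) :
    ‖∑ n ∈ Finset.Ioc a b, e (D 0 n)‖ ≤ yangKRHS η h (j + 1) ((b : ℝ) - a) lam := by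
  have hπ := Real.pi_pos
  have hh0 : 0 < h := by linarith
  set J : ℝ := yangJ j with hJdef
  have hJ4 : 4 ≤ J := four_le_yangJ hj
  have hJ0 : 0 < J := by linarith
  set Jn : ℕ := 2 ^ (j - 1) with hJn
  have hJnJ : (Jn : ℝ) = J := by rw [hJn, hJdef, yangJ]; push_cast; ring
  have hJn4 : 4 ≤ Jn := by
    rw [hJn]
    calc 4 = 2 ^ 2 := by norm_num
      _ ≤ 2 ^ (j - 1) := Nat.pow_le_pow_right (by norm_num) (by omega)
  set N : ℝ := (b : ℝ) - a with hN
  have hN1 : 1 ≤ N := by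
    have : a + 1 ≤ b := hab
    have : ((a : ℤ) : ℝ) + 1 ≤ b := by exact_mod_cast this
    rw [hN]; linarith
  have hN0 : 0 < N := by linarith
  have hA'0 : 0 < yangA η h (j + 1) := yangA_pos hη hh (j + 1) (by omega)
  have hB'0 : 0 < yangB η (j + 1) := yangB_pos hη (j + 1) (by omega)
  -- roots
  set ρ : ℝ := lam ^ (1 / (4 * J - 2)) with hρdef
  set θ : ℝ := h ^ (1 / J) with hθdef
  set ν : ℝ := N ^ (1 / J) with hνdef
  have hρ0 : 0 < ρ := Real.rpow_pos_of_pos hlam _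
  have hθ0 : 0 < θ := Real.rpow_pos_of_pos hh0 _
  have hν0 : 0 < ν := Real.rpow_pos_of_pos hN0 _
  have hθpow : θ ^ Jn = h := by
    rw [hθdef, ← Real.rpow_natCast, ← Real.rpow_mul hh0.le, hJnJ, one_div_mul_cancel hJ0.ne',
      Real.rpow_one]
  have hνpow : ν ^ Jn = N := by
    rw [hνdef, ← Real.rpow_natCast, ← Real.rpow_mul hN0.le, hJnJ, one_div_mul_cancel hJ0.ne',
      Real.rpow_one]
  have hθinv : h ^ (-(1 / J)) = θ⁻¹ := by rw [hθdef, Real.rpow_neg hh0.le]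
  -- the target in root form
  rw [yangKRHS_succ_eq η h hj hN0 hlam, ← hJdef, ← hρdef, ← hθdef, ← hνdef, ← hJn]
  -- the trivial bound
  have hS0 : 0 ≤ ‖∑ n ∈ Finset.Ioc a b, e (D 0 n)‖ := norm_nonneg _
  have htriv : ‖∑ n ∈ Finset.Ioc a b, e (D 0 n)‖ ≤ N := by
    refine (norm_sum_e_le_card _ (fun n => D 0 n)).trans ?_
    rw [Int.card_Ioc, hN]
    have h1 : (((b - a).toNat : ℕ) : ℤ) = b - a := Int.toNat_of_nonneg (by omega)
    have h2 : (((b - a).toNat : ℕ) : ℝ) = ((b - a : ℤ) : ℝ) := by exact_mod_cast h1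
    rw [h2]; push_cast; exact le_rfl
  have hνp0 : 0 ≤ ν ^ (Jn - 1) := pow_nonneg hν0.le _
  have hT1 : 0 ≤ yangA η h (j + 1) * θ * N * ρ :=
    mul_nonneg (mul_nonneg (mul_nonneg hA'0.le hθ0.le) hN0.le) hρ0.le
  have hT2 : 0 ≤ yangB η (j + 1) * ν ^ (Jn - 1) * ρ⁻¹ :=
    mul_nonneg (mul_nonneg hB'0.le hνp0) (inv_nonneg.2 hρ0.le)
  -- `A_{j+1} θ ≥ δ ≥ 1`
  have hAθ : 1 ≤ yangA η h (j + 1) * θ := by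
    rw [yangA_succ η h hj, ← hJdef, hθinv]
    have hδ1 := one_le_yangDeltaJ hη.le J
    have hcA : 0 ≤ yangCJ J * Real.sqrt (yangA η h j) * θ :=
      mul_nonneg (mul_nonneg (yangCJ_pos hJ4).le (Real.sqrt_nonneg _)) hθ0.le
    have : yangDeltaJ η J * (θ⁻¹ + yangCJ J * Real.sqrt (yangA η h j)) * θ
        = yangDeltaJ η J * (1 + yangCJ J * Real.sqrt (yangA η h j) * θ) := by field_simp
    rw [this]
    nlinarith
  ----------------------------------------------------------------
  -- Range 1 (`λ ≥ 1`)
  ----------------------------------------------------------------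
  rcases le_or_gt 1 lam with hlam1 | hlam1
  · have hρ1 : 1 ≤ ρ := Real.one_le_rpow hlam1 (div_nonneg zero_le_one (by linarith))
    calc ‖∑ n ∈ Finset.Ioc a b, e (D 0 n)‖ ≤ N := htriv
      _ = 1 * N * 1 := by ring
      _ ≤ yangA η h (j + 1) * θ * N * ρ :=
          mul_le_mul (mul_le_mul_of_nonneg_right hAθ hN0.le) hρ1 zero_le_one
            (mul_nonneg (mul_nonneg hA'0.le hθ0.le) hN0.le)
      _ ≤ _ := le_add_of_nonneg_right hT2
  ----------------------------------------------------------------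
  -- Range 2 (`N ≤ 2336`)
  ----------------------------------------------------------------
  rcases le_or_gt N 2336 with hN2336 | hN2337
  · have hthr := yang_threshold hη hh (j := j + 1) (by omega)
    rw [show j + 1 - 2 = j - 1 by omega, ← hJn] at hthr
    have hP0 : 0 < yangA η h (j + 1) * yangB η (j + 1) := mul_pos hA'0 hB'0
    have hν_le : ν ≤ 4 * (yangA η h (j + 1) * yangB η (j + 1)) * θ := by
      have h1 : ν ^ Jn ≤ (4 * (yangA η h (j + 1) * yangB η (j + 1)) * θ) ^ Jn := by
        rw [hνpow, mul_pow, mul_pow, hθpow]; linarith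
      exact (pow_le_pow_iff_left₀ hν0.le
        (mul_nonneg (mul_nonneg (by norm_num) hP0.le) hθ0.le) (by omega)).1 h1
    have key : N ≤ yangA η h (j + 1) * θ * N * ρ + yangB η (j + 1) * ν ^ (Jn - 1) * ρ⁻¹ := by
      rw [← sub_nonneg]
      have hνJ : N = ν ^ (Jn - 1) * ν := by rw [← pow_succ, Nat.sub_add_cancel (by omega), hνpow]
      have e1 : yangA η h (j + 1) * θ * N * ρ + yangB η (j + 1) * ν ^ (Jn - 1) * ρ⁻¹ - N
          = ((yangA η h (j + 1) * θ * N) * ρ ^ 2 - N * ρ + yangB η (j + 1) * ν ^ (Jn - 1)) / ρ := by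
        rw [eq_div_iff hρ0.ne']; field_simp; ring
      rw [e1]
      refine div_nonneg (quad_nonneg (mul_pos (mul_pos hA'0 hθ0) hN0) ?_) hρ0.le
      calc N * N = N * (ν ^ (Jn - 1) * ν) := by rw [← hνJ]
        _ ≤ N * (ν ^ (Jn - 1) * (4 * (yangA η h (j + 1) * yangB η (j + 1)) * θ)) :=
            mul_le_mul_of_nonneg_left (mul_le_mul_of_nonneg_left hν_le hνp0) hN0.le
        _ = 4 * (yangA η h (j + 1) * θ * N) * (yangB η (j + 1) * ν ^ (Jn - 1)) := by ring
    exact htriv.trans key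
  ----------------------------------------------------------------
  -- Range 3 (`λ ≤ λ₀`)
  ----------------------------------------------------------------
  by_cases hR3 : (ν * ρ) ^ (2 * Jn) ≤ 1024 / (9 * π * η)
  · have hBinv := yangB_pow_ge hη (j + 1) (by omega)
    have h2Jn : 2 ^ (j + 1 - 1) = 2 * Jn := by
      rw [hJn, show j + 1 - 1 = (j - 1) + 1 by omega, pow_succ]; ring
    rw [h2Jn] at hBinv
    have hνρ : ν * ρ ≤ yangB η (j + 1) :=
      (pow_le_pow_iff_left₀ (mul_nonneg hν0.le hρ0.le) hB'0.le (by omega)).1 (hR3.trans hBinv)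
    have key : N ≤ yangB η (j + 1) * ν ^ (Jn - 1) * ρ⁻¹ := by
      have hνJ : N = ν ^ (Jn - 1) * ν := by rw [← pow_succ, Nat.sub_add_cancel (by omega), hνpow]
      rw [hνJ]
      have : ν ^ (Jn - 1) * ν = (ν * ρ) * ν ^ (Jn - 1) * ρ⁻¹ := by field_simp
      rw [this]
      exact mul_le_mul_of_nonneg_right (mul_le_mul_of_nonneg_right hνρ hνp0) (inv_nonneg.2 hρ0.le)
    calc ‖∑ n ∈ Finset.Ioc a b, e (D 0 n)‖ ≤ N := htriv
      _ ≤ yangB η (j + 1) * ν ^ (Jn - 1) * ρ⁻¹ := key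
      _ ≤ _ := le_add_of_nonneg_left hT1
  have hR3' : 1024 / (9 * π * η) ≤ (ν * ρ) ^ (2 * Jn) := (not_le.1 hR3).le
  ----------------------------------------------------------------
  -- Main range: `q = ⌊x⌋ + 1`, the differenced sums, the weighted sum, the `A`-process
  ----------------------------------------------------------------
  have hρ1 : ρ ≤ 1 := Real.rpow_le_one hlam.le hlam1.le (div_nonneg zero_le_one (by linarith))
  have hx0 : 0 < (ρ ^ 2)⁻¹ := by positivity
  set q : ℕ := ⌊(ρ ^ 2)⁻¹⌋₊ + 1 with hq
  have hq1 : 1 ≤ q := by omega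
  have hqx : (ρ ^ 2)⁻¹ < q := by rw [hq]; push_cast; exact Nat.lt_floor_add_one _
  have hq2x : (q : ℝ) ≤ 2 * (ρ ^ 2)⁻¹ := by
    have hx1 : 1 ≤ (ρ ^ 2)⁻¹ := by
      rw [one_le_inv₀ (by positivity)]; nlinarith
    rw [hq]; push_cast; linarith [Nat.floor_le hx0.le]
  have hs0 : 0 < 1 / (2 * J - 2) := by apply one_div_pos.2; linarith
  have hs1 : 1 / (2 * J - 2) < 1 := by rw [div_lt_one (by linarith)]; linarith
  have hθ2 : h ^ (2 / J) = θ ^ 2 := by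
    rw [hθdef, ← Real.rpow_natCast, ← Real.rpow_mul hh0.le]; congr 1; push_cast; ring
  have hM₁0 : 0 ≤ yangA η h j * θ ^ 2 * N :=
    mul_nonneg (mul_nonneg (yangA_pos hη hh j hj).le (sq_nonneg _)) hN0.le
  have hM₂0 : 0 ≤ yangB η j * N ^ (1 - 2 / J) :=
    mul_nonneg (yangB_pos hη j hj).le (Real.rpow_nonneg hN0.le _)
  have hF : ∀ r : ℕ, 1 ≤ r → ‖∑ n ∈ Finset.Ioc a (b - r), e (D 0 ((n + r : ℤ)) - D 0 n)‖
      ≤ (yangA η h j * θ ^ 2 * N) * ((r : ℝ) * lam) ^ (1 / (2 * J - 2))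
        + (yangB η j * N ^ (1 - 2 / J)) * ((r : ℝ) * lam) ^ (-(1 / (2 * J - 2))) := by
    intro r hr
    have := kth_diff hη hh hj IH hab hlam hD hbd hr
    rw [← hJdef, ← hN, hθ2] at this
    linarith
  have hW := kth_weighted (F := fun r => ‖∑ n ∈ Finset.Ioc a (b - r), e (D 0 ((n + r : ℤ)) - D 0 n)‖)
    hM₁0 hM₂0 hlam hs0 hs1 hq1 hF
  have hAP := aProcess_yang (fun y => D 0 y) hab.le hq1
  rw [← hN] at hAP
  have hW0 : 0 ≤ ∑ r ∈ Finset.Ico 1 q, (1 - (r : ℝ) / q) *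
      ‖∑ n ∈ Finset.Ioc a (b - r), e (D 0 ((n + r : ℤ)) - D 0 n)‖ := by
    refine Finset.sum_nonneg fun r hr => mul_nonneg ?_ (norm_nonneg _)
    rw [Finset.mem_Ico] at hr
    have hqpos : (0 : ℝ) < q := by exact_mod_cast hq1
    rw [sub_nonneg, div_le_one hqpos]; exact_mod_cast hr.2.le
  -- make the sums opaque
  generalize ∑ r ∈ Finset.Ico 1 q, (1 - (r : ℝ) / q) *
      ‖∑ n ∈ Finset.Ioc a (b - r), e (D 0 ((n + r : ℤ)) - D 0 n)‖ = W at hW hAP hW0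
  generalize ‖∑ n ∈ Finset.Ioc a b, e (D 0 n)‖ = S at hS0 htriv hAP ⊢
  have hN2337' : (2337 : ℝ) ≤ N := by
    have h1 : (2336 : ℝ) < ((b - a : ℤ) : ℝ) := by push_cast; rw [← hN]; exact hN2337
    have h2 : (2336 : ℤ) < b - a := by exact_mod_cast h1
    have h3 : (2337 : ℤ) ≤ b - a := h2
    have h4 : ((2337 : ℤ) : ℝ) ≤ ((b - a : ℤ) : ℝ) := by exact_mod_cast h3
    push_cast at h4; rw [hN]; exact h4
  exact kth_main_real hη hh hj hN2337' hlam hlam1 hS0 hW0 hq1 hqx hq2x hR3' hW hAP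

end step



/-! ### Yang's Lemma 2.5 -/

section final

variable {η h : ℝ}

/-- The order-`3` right-hand side is that of Lemma 2.4: `A₃ h^{1/2} N λ^{1/6} + B₃ N^{1/2} λ^{-1/6}`.
[cite: Yang2024, Lemma 2.5] -/
theorem yangKRHS_three (η : ℝ) {h N lam : ℝ} :
    yangKRHS η h 3 N lam = yangA3 η h * Real.sqrt h * N * lam ^ (1 / 6 : ℝ)
      + yangB3 η * Real.sqrt N * lam ^ (-(1 / 6 : ℝ)) := by
  unfold yangKRHS
  rw [yangA_three, yangB_three, yangJ_three, Real.sqrt_eq_rpow, Real.sqrt_eq_rpow]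
  norm_num

/-- **Yang's explicit `k`-th derivative test, the case `f^{(k)} > 0`**, for every `k ≥ 3`, by
induction from Lemma 2.4 (`Literature.NumberTheory.LFunctions.VdC.thirdDerivTest_yang_pos`) through
`Literature.NumberTheory.LFunctions.VdC.kth_step`. [cite: Yang2024, Lemma 2.5] -/
theorem kthDerivTest_yang_pos (hη : 0 < η) (hh : 1 ≤ h) (k : ℕ) (hk : 3 ≤ k) :
    ∀ ⦃a b : ℤ⦄ ⦃lam : ℝ⦄ ⦃D : ℕ → ℝ → ℝ⦄, a < b → 0 < lam → DerivFamily D a b k →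
      (∀ y ∈ Set.Icc (a : ℝ) b, lam ≤ D k y ∧ D k y ≤ h * lam) →
      ‖∑ n ∈ Finset.Ioc a b, e (D 0 n)‖ ≤ yangKRHS η h k ((b : ℝ) - a) lam := by
  induction k, hk using Nat.le_induction with
  | base =>
    intro a b lam D hab hlam hD hbd
    rw [yangKRHS_three]
    exact thirdDerivTest_yang_pos (f := D 0) (f' := D 1) (f'' := D 2) (f''' := D 3) hab.le hlam hh hη
      (hD 0 (by norm_num)) (hD 1 (by norm_num)) (hD 2 (by norm_num)) hbd
  | succ k hk ih =>
    intro a b lam D hab hlam hD hbd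
    exact kth_step hη hh hk ih hab hlam hD hbd

/-- **Yang's explicit `k`-th derivative test** (Yang 2024, Lemma 2.5; Patel–Yang 2024, Lemma 1.4):
let `k ≥ 3`, `a < b` integers (`N = b - a`), `D 0, …, D k` a family of successive derivatives on
`[a, b]` (`Literature.NumberTheory.LFunctions.VdC.DerivFamily`) with `λ ≤ D^{(k)} ≤ hλ` on `[a, b]`,
or `λ ≤ -D^{(k)} ≤ hλ` on `[a, b]` (`λ > 0`, `h ≥ 1`). Then for every `η > 0`,
`‖∑_{a<n≤b} e(D₀(n))‖ ≤ A_k(η, h) h^{2/K} N λ^{1/(2K-2)} + B_k(η) N^{1-2/K} λ^{-1/(2K-2)}`,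
`K = 2^{k-1}`, with Yang's constants `Literature.NumberTheory.LFunctions.VdC.yangA`,
`Literature.NumberTheory.LFunctions.VdC.yangB` (`A₃, B₃` of Lemma 2.4 and the recursion (1.3)–(1.5)
of Patel–Yang). [cite: Yang2024, Lemma 2.5] [cite: PatelYang2024, Lemma 1.4] -/
theorem kthDerivTest_yang (hη : 0 < η) (hh : 1 ≤ h) {k : ℕ} (hk : 3 ≤ k) {a b : ℤ} {lam : ℝ}
    {D : ℕ → ℝ → ℝ} (hab : a < b) (hlam : 0 < lam) (hD : DerivFamily D a b k)
    (hbd : (∀ y ∈ Set.Icc (a : ℝ) b, lam ≤ D k y ∧ D k y ≤ h * lam) ∨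
      (∀ y ∈ Set.Icc (a : ℝ) b, lam ≤ -D k y ∧ -D k y ≤ h * lam)) :
    ‖∑ n ∈ Finset.Ioc a b, e (D 0 n)‖ ≤ yangKRHS η h k ((b : ℝ) - a) lam := by
  rcases hbd with hpos | hneg
  · exact kthDerivTest_yang_pos hη hh k hk hab hlam hD hpos
  · -- replace the family by its negative
    have hD' : DerivFamily (fun i y => -D i y) a b k := fun i hi y hy => (hD i hi y hy).neg
    have h := kthDerivTest_yang_pos hη hh k hk hab hlam hD' hneg
    rwa [norm_sum_e_neg] at h

end final


end VdC
end Literature.NumberTheory.LFunctions
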